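import Mathlib
import Summits.NavierStokesRegularity.NavierStokesRegularity.Theses.EulerZoomLiouville
import Summits.NavierStokesRegularity.NavierStokesRegularity.Theorems.EulerZoomLiouvillePowerGaugeEulerLiouvilleBirthDefsFive
import Summits.NavierStokesRegularity.NavierStokesRegularity.Theorems.EulerZoomLiouvillePowerGaugeEulerLiouvillePastIrrotational
import Summits.NavierStokesRegularity.NavierStokesRegularity.Theorems.EulerZoomLiouvillePowerGaugeEulerLiouvilleCasimirFloorTransport
import Summits.NavierStokesRegularity.NavierStokesRegularity.Theorems.EulerZoomLiouvillePowerGaugeEulerLiouvilleSwirlfreeLedgerDecay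
import Summits.NavierStokesRegularity.NavierStokesRegularity.Theorems.EulerZoomLiouvillePowerGaugeEulerLiouvilleBackwardTools
import Summits.NavierStokesRegularity.NavierStokesRegularity.Theorems.EulerZoomLiouvillePowerGaugeEulerLiouvilleNeedleAxisymBand
import Summits.NavierStokesRegularity.NavierStokesRegularity.Theorems.EulerZoomLiouvillePowerGaugeEulerLiouvilleCasimirHaulLedgerFlow
import Summits.NavierStokesRegularity.NavierStokesRegularity.Theorems.EulerZoomLiouvillePowerGaugeEulerLiouvilleCasimirHaulTravel
import Summits.NavierStokesRegularity.NavierStokesRegularity.Theorems.EulerZoomLiouvillePowerGaugeEulerLiouvilleCasimirHaulHaulingInequality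
import Literature.Analysis.FunctionSpaces.LogPoincareSmallSets
import Literature.Analysis.FluidPDE.SelfSimilarEulerProfile
import Literature.Analysis.FluidPDE.SelfSimilarCollapseAnsatz
import Literature.Analysis.FluidPDE.AxisymHouLiVariables
import Literature.Analysis.FluidPDE.TaoEnstrophyLocalisation
import Literature.Analysis.FluidPDE.WeakSolution
import Literature.Analysis.FunctionSpaces.SobolevDomain
import Literature.Analysis.FluidPDE.AxisymmetricEuler
import Literature.Analysis.FluidPDE.ClassicalSolution
import Literature.Analysis.FluidPDE.VectorCalculus
import HarnessLib.Audit

/-!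
v119 TARGET SYNC (g12, 2026-08-29T15:3xZ; asked by LEAD 19832 g17, nsreg STATUS 15:29:40Z — the LAST registration of lineage ns-typeII-p2, D-0168 E1):
birth v119 (commit a0222d65cbc8, sha16 af7a41b1fec37376; 52 stubs / 49 filled / 3 open) adds spiral parity for the four regularity-free senses —
binder #41 `¬ IsPastSpiralTameWeak ρ u` (`Theorems/…BirthDefsFive.lean` p727264; filled stub `stub_pastSpiralTameWeak := Spiral.pastSpiralTameWeak_trivial …`,
ns-ezl-w3 g9 p728352) inserted after `¬ IsPastSpiralSubExtremal ρ u` (40 → 41 binders).  This file: `import …BirthDefsFive` (was `…Four`), target re-copied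
VERBATIM from birth v119, compositions take the new hypothesis (`_ntw`, dropped — H6 keeps its text); H1–H6 texts UNCHANGED (farm rc 0, sorries 1 = H6).
v118 TARGET SYNC (g12, 2026-08-29T15:1xZ; asked by LEAD 19832 g17, nsreg STATUS 15:01:44Z): the LEAD's birth v118 (commit a7acbce54963, sha16 3de4b498580094dc;
51 stubs / 48 filled / 3 open) KILLED the sub-extremal SPIRAL stratum of line `relative_equilibria` BY NAME — binder #40 `¬ IsPastSpiralSubExtremal ρ u`
(`Theorems/…BirthDefsFour.lean` p725060; filled stub `stub_pastSpiralSubExtremal := Spiral.pastSpiralSubExtremal_trivial …`, p727289) inserted after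
`¬ IsPastSelfSimilarSubExtremal ρ u` in `stub_nonSelfSimilarRest` (39 → 40 binders).  This file: `import …BirthDefsFour` (was `…Three`), the target
`Sig.stub_nonSelfSimilarRest` re-copied VERBATIM from birth v118, the compositions' binder lists take the new hypothesis (`_nsp`, dropped — H6 is the
line's own complement and keeps its text); H1–H6 statement texts UNCHANGED, every proof re-checked (farm rc 0, sorries 1 = H6).
v117 IMPORT SWITCH (g12, 2026-08-29T14:1xZ; asked by LEAD 19832 g16 FINAL): the LEAD's birth v117 (commit 5e45166c439e, sha16 04b64fff177970e8) moved the 52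
binder predicates into the reviewed, importable `Theorems/…BirthDefs{,Two,Three}.lean` (namespace `…Theorems.PowerGaugeEulerLiouville.Birth`).  This file now
IMPORTS `…BirthDefsThree` and OPENS that namespace; the 45 local verbatim copies (`E3`, `InClass`, …, `IsSlabBoundedSwirlFree`) are DELETED, so every predicate
name below denotes the LEAD's own declaration; the target `Sig.stub_nonSelfSimilarRest` is re-copied VERBATIM from birth v117 (39 binders, text = v116's);
H1–H6 statement texts UNCHANGED, every proof re-checked unchanged (farm rc 0, sorries 1 = H6).  Size 183 213 B → ≈112 kB.
v116 COPY SYNC (g11, 2026-08-29T13:3xZ): the LEAD's birth v116 (sha16 2d4063891c2dccd4) added THREE any-axis binders `¬ (∃ R : E3 ≃ₗᵢ[ℝ] E3, …)` (slab-bounded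
swirl-free / axisym slow drifting / DSS classical tame, conjugated by `R`) to `stub_nonSelfSimilarRest` (36 → 39 binders); this file's copy of the target is
VERBATIM v116 and the compositions ignore the three new binders (`_nS' _n13' _n29'`); all statement texts of this line's own stubs UNCHANGED.
v115 COPY SYNC (g11, 2026-08-29T12:4xZ) — THE LINE IS ABSORBED: the LEAD's birth v115 (97807a79e132, sha16 282f55b374550410) added the binder
`¬ IsSlabBoundedSwirlFree u p` (THIS line's stratum, text verbatim) to `stub_nonSelfSimilarRest` and filled its new stub `stub_slabBoundedSwirlFree` IN THE
SKELETON by name (`CasimirHaul.slabBoundedSwirlFree_trivial`, ns-sfl-p1 g10 p718198 = the Theorems ports of H1–H4 + the irrotational endgame); this file's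
copies of `Sig.stub_nonSelfSimilarRest` (36 binders) and `IsSlabBoundedSwirlFree` (moved above the target) are VERBATIM v115; H1–H6 statement texts UNCHANGED;
`nonSelfSimilarRest_of_face : stub_haulFace → Sig.stub_nonSelfSimilarRest` is now a re-ordering of binders (H6 ≡ the LEAD's open stub up to one binder's
position) — nothing of this line remains open except the wall itself.
v114 COPY SYNC (g11, 2026-08-29T12:0xZ): the LEAD's birth v114 (16868d2385e3, sha16 61a0dbc57b6394c4) added the binder `¬ IsChiralTubePast u p` (the
chiral-tube stratum of line `chiral_anchor`, killed by name in the skeleton) to `stub_nonSelfSimilarRest`; this file's copies of `Sig.stub_nonSelfSimilarRest` and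
`IsChiralTubePast` are now VERBATIM v114; H1–H6 statement texts are UNCHANGED (the H6 face keeps its binder list — the composition simply does not hand the new
binder to H6), so every proof / by-name filler stands as before.
# Line `casimir_haul` — «THE CAPACITY PRICE OF HAULING THE CASIMIR BLOB HOME» (ideator ns-idea-11 g10, line g10-1)
# crux `EulerZoomLiouville.PowerGaugeEulerLiouville` = stmt-NavierStokesRegularity-19832; target (BY NAME, VERBATIM v110 text):
# the LEAD skeleton's open stub `Sig.stub_nonSelfSimilarRest` (`Lines/birth.lean` v110, ns-typeII-p2 g15).

NO SUMMIT AND NO CRUX IS PROVED HERE.  This is a SKELETON LINE (files-only ideator seat).  REV6 (g11): ONE sorried stub — `stub_haulFace` (H6, the open complement =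
the wall); EVERY KILL STUB IS CLOSED (H1, H2, H3, H4a by name from tree theorems; H4, H4c proved in-file and ported to Theorems by ns-sfl-p1 g10) and
`slabBoundedSwirlFree_trivial` below is SORRY-FREE: the classical axisymmetric swirl-free slab-bounded stratum of the class is EMPTY for every
`ρ ∈ (0,½]` and the kernel-checked compositions `nonSelfSimilarRest_of :
stub_ledgerFlow → stub_logPoincareSmallSets → stub_haulingInequality → stub_haulRace → stub_haulFace → Sig.stub_nonSelfSimilarRest`,
`nonSelfSimilarRest_of_split` (H4 = H4a + H4c), `nonSelfSimilarRest_of_rev3`, `nonSelfSimilarRest_of_rev4` and `nonSelfSimilarRest_of_rev6 : stub_haulFace →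
Sig.stub_nonSelfSimilarRest` (all kill stubs discharged).  FILLED BY NAME (REV3/REV4/REV6, statements unchanged): H1 `stub_ledgerFlow` :=
`Theorems.PowerGaugeEulerLiouville.CasimirHaul.hasLedgerFlows_of_slabBoundedSwirlFree` (ns-sfl-p1 g10, p714362), H2 `stub_logPoincareSmallSets` :=
`Literature.Analysis.FunctionSpaces.logPoincare_smallSets` (ns-ezl-w2 g7, p714183, GilbargTrudinger2001 T7.15/L7.16), H3 `stub_haulingInequality` := `fun _ =>
Theorems.PowerGaugeEulerLiouville.CasimirHaul.haulingInequality` (ns-ezl-w2 g7, unconditional) and H4a `stub_haulTravel` :=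
`Theorems.PowerGaugeEulerLiouville.CasimirHaul.haulTravel` (ns-sfl-p1 g10, p715646).  PROVED IN-FILE (statements unchanged): H4 `stub_haulRace` (REV2, `haulRace_of : stub_haulTravel → stub_haulBook → stub_haulRace`, from the proved H4 toolkit: blob of
positive volume, FLOOR ⇒ MOMENT BUDGET, RESIDENCE ⇒ BANISHMENT, exponent race) and H4c `stub_haulBook` (REV3, sorry-free: per-slice `HaulingInequality`
+ FLOOR moment comparison + `M·L(M) ≤ (2+4 log b)(m + b⁻²)` + shell/Young + AM–GM with constant parameters, Tonelli, the `E`-gauge window budgets and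
the `A`-gauge slice budget at the single scale `3b`, `log b ≤ b^{ρ₁}/ρ₁`), plus the FILLED endgame `irrotationalEndgame` (by name over
`Theorems.PowerGaugeEulerLiouville.PastIrrotational.ae_eq_zero_of_gauge_of_pastIrrotational`).  VERBATIM-COPY DECLARATION: the predicates
`InClass … IsClassicalConcentrating` and the target `Sig.stub_nonSelfSimilarRest` below are COPIED VERBATIM (docstrings included) from
`Cruxes/PowerGaugeEulerLiouville/Lines/birth.lean` v110 (sha256[:16] = `0609e282b4cf8348`, 2026-08-29T07:05Z; identical in v112 `2bb4b0975b5b60c0`;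
extraction script `extract_birth.py` = dependency closure of the 34 negated binders of the target) so that this file NEVER imports `Lines.birth` and the
target is concluded BY NAME with the LEAD's exact text; a LEAD re-word of any copied predicate obliges a re-copy (successor duty, HOME HANDOFF).

## The stratum (ρ-free, envelope-free)
`IsSlabBoundedSwirlFree u p`: classical Euler on `(−∞,0) × ℝ³`, every slice axisymmetric AND swirl-free, and the velocity BOUNDED ON EVERY COMPACT
PAST TIME-SLAB `[T₁,T₀] ⊂ (−∞,0)` (a qualitative bound, NO rate, NO drift exponent, NO confinement envelope).  It CONTAINS the killed strata
`IsSwirlFreeDrifting` (κ > ½), `IsSwirlFreeSlowDrifting` (κ ∈ ((1−ρ)/(2−ρ),1)), `IsMirrorOutgoing` and the swirl-free half of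
`IsAxisymSlowDrifting` — all of which needed a DRIFT ENVELOPE `‖u(τ,x)‖ ≤ M(−τ)^{−κ}`; the residue «κ ≤ (1−ρ)/(2−ρ)» recorded in RESIDUE-MEMO-19832
(g14) and in Seregin's own §4 (arXiv:2606.29468, Prop. 4.1: the Casimir ledger consumed through the envelope) is what this line removes.

## The idea (one paragraph)
Swirl-free axisymmetry makes `η = ω_θ/r` a MATERIAL CASIMIR (Majda–Bertozzi §2.3.3): the super-level blob `S = {η(t₀) ≥ λ} ∩ B̄(R₀)` (volume
`v > 0` as soon as the slice `t₀` carries vorticity) is carried by the flow with its volume and its ledger floor `‖curl u‖ ≥ λ r`.  Two prices are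
then charged to the member's OWN `E`-gauge `∫_{−a²}^{0}∫_{B_a}‖∇u‖² ≤ c a^{1−ρ}`:  (FLOOR) while a part `w` of the blob sits inside `B_b` it costs
enstrophy `≥ ½λ²∫_{blob∩B_b} r² ≥ λ² w²/(8πb)` per unit time, so within the window `(−16b²,0)` the blob can afford only `O(b^{2−ρ})` units of
residence in `B_b` — at some `t₁ ∈ (−16b², t₀)` half of it is OUTSIDE `B_b` (banishment; no envelope needed, the budget does it); (HAUL) but between
`t₁` and `t₀` that half must be HAULED HOME through the slab `R₀ < |z| < b/2`, and moving a thin parcel of cross-section `α` axially at mean speed `m`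
through fluid costs Dirichlet energy `≥ c m²/(1 + log(b²/α))` per slice (the 2-D LOG-CAPACITY / Moser–Trudinger price of a small set: thin needles
slide cheaply, but only logarithmically so), while the FLOOR caps how thin-and-long the parcel can be inside `B_{2b}` (its `r²`-moment is paid
for).  Cauchy–Schwarz over slices and times + Jensen on `y ↦ y log(1/y)` turn «net axial haul ≥ v b/8» into
`λ² v² b² ≤ C c² b^{2−2ρ} (1 + log b)`, i.e. `b^{2ρ} ≤ C (c/λv)² log b` — false for `b` large, for EVERY `ρ > 0`.  Hence every slice is
irrotational, and irrotational members are trivial (`PastIrrotational`, in the tree).  Lower-order «reference-mean» and «far-field» terms are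
paid by the `A`-gauge and the same moment budget (`≲ c b^{1−3ρ/2}/λ ≪ v b`).  The `D`-gauge, the local energy inequality and `ρ ≤ ½` are NOT used.

## Stubs (sizes are guesses; H = this line's labels)
* H1 `stub_ledgerFlow` — FILLED BY NAME (REV3: `CasimirHaul.hasLedgerFlows_of_slabBoundedSwirlFree`, p714362) — Lagrangian parcels: for a member of the stratum, every marked blob `S = {x ∈ B̄(R₀) : λ r ≤ ‖curl u(t₀)‖}` has a
  LEDGER FLOW on `[t₁,t₀]` (`IsLedgerFlow`: jointly continuous maps `X s`, trajectories solving `ẋ = u`, injective on `S`, images measurable of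
  the same volume with the `ℝ≥0∞` change-of-variables identity, uniformly bounded, carrying `λ r ≤ ‖curl u(s)‖`).  Re-assembly of the tree's
  `CasimirFloorTransport` / `SwirlfreeLedgerFlow|Confinement` machinery (`omegaTilde_evolutionMap_eq`, `det_fderiv_evolutionMap_eq_one_of_divergence`,
  `norm_evolutionMap_sub_le` with κ = 0 on a slab: the slab bound replaces the drift envelope).
* H2 `stub_logPoincareSmallSets` — FILLED BY NAME (REV4: `Literature.Analysis.FunctionSpaces.logPoincare_smallSets`, p714183, `C = 64`) —
  planar log-Poincaré for small sets: `|⨍_A f − ⨍_{B_R} f|² ≤ C (1 + log(πR²/|A|)) ∫_{B_R}‖∇f‖²`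
  for `f ∈ C¹(ℝ²)`, `A ⊆ B_R ⊂ ℝ²` (corollary of 2-D exponential integrability, GilbargTrudinger2001 Thm 7.15 + Lemma 7.16, p. 162ff, by Jensen).
* H3 `stub_haulingInequality` — FILLED BY NAME (REV6: `CasimirHaul.haulingInequality`, ns-ezl-w2 g7; M) — H2 ⇒ the per-slice HAULING INEQUALITY in `ℝ³` (`HaulingInequality`): for `v ∈ C¹`, `|w| ≤ 1`, `A` inside the
  solid cylinder `{r < 2b, |z| < b}`: `|∫_A w(z) v₃| ≤ C √(∫_cyl ‖∇v‖²) √(M_A (1 + log b + log⁺(b/M_A))) + C √(M_A/b²) √(∫_cyl ‖v‖²)`,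
  `M_A = ∫_A r²` (Fubini in `z`, planar bathtub `|A_z|² ≤ 2π∫_{A_z} r²`, Cauchy–Schwarz, Jensen with the concave majorant of `y log(1/y)`).
* H4 `stub_haulRace` — PROVED in-file (REV2, `haulRace_of`) from H4a + H4c (H4c itself proved in REV3): `HaulingInequality` ⇒ for a member of the class (any `ρ > 0`) in the
  stratum with ledger flows, every slice is irrotational.  Proved pieces (H4 toolkit): `exists_ledgerBlob_pos` (a slice with vorticity has a blob of
  positive volume, `λ ≤ 1`), `moment_le_frobenius` / `moment_budget` (FLOOR `λ²r² ≤ |ω|² ≤ 16‖∇u‖²_F` + single-scale `E`-gauge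
  `TimePeriodic.setLIntegral_window_le_of_gaugeE`: `∫_{t₁}^{t₀}∫_{X_sS ∩ B_a} r² ≤ 16 c a^{1−ρ}/λ²`), `exists_banished` (RESIDENCE ⇒ BANISHMENT by the
  tube bathtub `NeedleAxisymBand.sq_volume_le_integral_cylRadius_sq`), and the race (`b^{ρ₁} > 18432(c+1)/(λ²v²)`, `b^{ρ₁/2} > 4K_aK_c(c+1)/(λv)`).
* H4a `stub_haulTravel` — FILLED BY NAME (REV4: `CasimirHaul.haulTravel`, p715646; M) — TRAVEL INEQUALITY: for a blob `S ⊆ B̄(b/4)` with a ledger flow on `[t₁,t₀]` and any `s₁` of the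
  window, `|S| ≤ |X_{s₁}S ∩ B_{3b}| + (K/b)·[∫_{t₁}^{t₀} |∫_{X_sS ∩ solidCyl b} w(x₃) u₃| + ∫_{t₁}^{t₀}∫_{X_sS ∩ shell_b} |u|]` with a fixed profile
  `|w| ≤ 1` (product cutoff `ψ = ζ(x₃/b)χ(Px/b)`, FTC along trajectories, Fubini on `S × [s₁,t₀]`, the flow's change of variables; `shell_b =
  haulShell b = {|x| < 3b, r ≥ b}`).  No gauge, no `ρ`.
* H4c `stub_haulBook` — PROVED in-file (REV3; no flow calculus): HAULING BOOKKEEPING: `HaulingInequality` + FLOOR + `E`/`A`-gauges at the single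
  scale `3b` bound the two time integrals of H4a by `K_ρ (c+1) b^{1−ρ₁/2}/λ` on windows `(t₁,t₀) ⊆ (−9b²,0]` of length `≤ b²`, `K_ρ = 13C√(2+4/ρ₁) +
  13(C+1)` (`axial_flux_le`: `M_A ≤ m(s)`, `M·L(M) ≤ (2+4 log b)(m(s) + b⁻²)`, AM–GM; `shell_volume_le`/`shell_traffic_le`: `b²|X_sS ∩ shell| ≤ m(s)`,
  Young; `slice_majorant`; `aemeasurable_cylDirichlet` (Tonelli from joint continuity of `∇u`); `cyl_dirichlet_budget`, `moment_budget`,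
  `Backward.lintegral_ball_le_of_gaugeA`; `book_algebra`: `log b ≤ b^{ρ₁}/ρ₁`, balanced AM–GM parameters).
* `irrotationalEndgame` — FILLED: irrotational classical members vanish (`PastIrrotational.ae_eq_zero_of_gauge_of_pastIrrotational`, `T₁ = 0`).
* H6 `stub_haulFace` (OPEN complement, honest) — the target's 34 negated binders VERBATIM plus `¬ IsSlabBoundedSwirlFree u p` ⇒ trivial.  This is
  exactly the LEAD's open stub minus the new stratum; nobody claims it is easier than the crux.  It is where the rest of the partition lives.

## Why this line / why novel (vs every listed route and line) / bears_on
bears_on: rung stmt-NavierStokesRegularity-19832 (`PowerGaugeEulerLiouville`), LEAD skeleton v110 open stub `Sig.stub_nonSelfSimilarRest`.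
Lever (five words): «log-capacity price of hauling Casimir blobs».  Nearest in-tree: `casimir_floor` (g3) / `CasimirFloorMember` / `AxisymSlowDrifting`
/ `mirror-moment` — all read the SAME Casimir floor but banish/return the blob through a DRIFT ENVELOPE (`M(−τ)^{−κ}`), whence the residue
κ ≤ (1−ρ)/(2−ρ); `swirl_capacity` prices RADIAL capacity of swirl `Γ = r u_θ` near the axis (a different Casimir, a different condenser, still an
envelope).  Here NO envelope: banishment is paid by the budget (RESIDENCE) and the return trip is priced by 2-D capacity (HAUL).  Nearest in print:
vorticity-growth bounds for axisymmetric swirl-free Euler from energy + Casimir constraints (Childress–Gilbert–Valiant 2016 doi:10.1017/jfm.2016.573;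
Lim–Jeong 2025 doi:10.1007/s00205-025-02103-1; Do 2019 doi:10.1007/s00205-019-01388-3), the no-swirl NS Liouville theorem of
Koch–Nadirashvili–Seregin–Šverák 2009 (diffusive maximum principle for η — unavailable for Euler), Seregin 2026 §4 (arXiv:2606.29468, ledger via
envelope).  None prices TRANSPORT by capacity against a parabolic-cylinder enstrophy budget (searched: corpus fts+vec, galaxy; NOTES «presearch»).
Cheapest falsifier: a classical axisymmetric swirl-free member with a non-trivial slice — e.g. test the bookkeeping on Hill's vortex / a translating
ring (both FAIL the `E`-gauge outright: enstrophy `Z₀` per unit time vs `c a^{1−ρ}`), and on the exactly/discretely self-similar swirl-free profiles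
(already dead in the tree: `SelfSimilarSwirlFree`, X2 `casimirRace`).  Instrument row that would refute the key lemma H4: an explicit family of
div-free swirl-free fields on `(−16b²,−1) × B_{4b}` carrying a λ-ledger blob of volume `v` from outside `B_b` into `B_{R₀}` with
`∫∫‖∇u‖² = o(λ² v² b^{1+ρ}/ (c log b))` — the hauling inequality H3 says no such family exists; a numerical counterexample to H3 on needles of
cross-section `e^{−b}` is the first thing a refuter should try (the log is sharp exactly there).
-/

noncomputable section

open MeasureTheory Set Filter Topology Metric
open scoped ENNReal NNReal ContDiff

set_option linter.dupNamespace false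
set_option maxSynthPendingDepth 3

namespace Summit.NavierStokesRegularity.NavierStokesRegularity.Cruxes.PowerGaugeEulerLiouville.CasimirHaul

open Summit.NavierStokesRegularity.NavierStokesRegularity.Theorems.PowerGaugeEulerLiouville.Birth

/-- The plane, for the planar log-Poincaré inequality. -/
abbrev E2 : Type := EuclideanSpace ℝ (Fin 2)

/-! ## The LEAD skeleton's binder predicates are IMPORTED since v117 (`Theorems/…BirthDefs{,Two,Three,Four,Five}.lean`, namespace
`…Theorems.PowerGaugeEulerLiouville.Birth`, opened above — the local verbatim copies of v110–v116 are gone); the target below is the LEAD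
skeleton's open stub `Sig.stub_nonSelfSimilarRest`, VERBATIM birth.lean v119 (it lives in the non-importable `Lines/birth.lean`, hence copied). -/

/-- Signature of `stub_nonSelfSimilarRest` (OPEN; reshaped v17–v74, binder history in the CENSUS files): in the window, a member with energy present at `t = −∞` lying in
NONE of the landed past / clock / DSS / weak strata named by the binders below (velocity-only binders since v54/v58) is trivial. -/
def Sig.stub_nonSelfSimilarRest : Prop :=
  ∀ ρ : ℝ, 0 < ρ → ρ ≤ 1 / 2 →
    ∀ (u : ℝ → E3 → E3) (p : ℝ → E3 → ℝ) (H : ℝ → E3 → E3 →L[ℝ] E3) (c : ℝ≥0),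
      InClass ρ u p H c → ¬ QuiescentPast u → ¬ IsPastSteady ρ u → ¬ IsWeakTamePast u H → ¬ PastFrozenDirection H →
        ¬ IsSelfSimilarVelocity u → ¬ IsCollapseClockC2 u →
        ¬ IsPastSelfSimilarClassical ρ u → ¬ IsPastSelfSimilarSubExtremal ρ u → ¬ IsPastSpiralSubExtremal ρ u → ¬ IsPastSpiralTameWeak ρ u → ¬ IsShapeFastClock ρ u →
        ¬ IsSwirlFreeDrifting u p → ¬ IsSwirlFreeSlowDrifting ρ u p → ¬ IsMirrorOutgoing ρ u p → ¬ IsSlabBoundedSwirlFree u p → ¬ (∃ R : E3 ≃ₗᵢ[ℝ] E3, IsSlabBoundedSwirlFree (fun τ x => R (u τ (R.symm x))) (fun τ x => p τ (R.symm x))) → ¬ IsAxisymSlowDrifting ρ u p → ¬ (∃ R : E3 ≃ₗᵢ[ℝ] E3, IsAxisymSlowDrifting ρ (fun τ x => R (u τ (R.symm x))) (fun τ x => p τ (R.symm x))) → ¬ IsTameBreather ρ u p → ¬ IsDiscreteBreather ρ u → ¬ IsDiscreteClock ρ u →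
        ¬ IsOffRateSelfSimilar ρ u →
        ¬ IsBernoulliClockedCore u p → ¬ IsHelicalTubePast ρ u p → ¬ IsChiralTubePast u p → ¬ IsStretchingBudgeted ρ u p → ¬ IsAnchoredBudgeted ρ u p →
        ¬ IsConfinedVortex ρ u p → ¬ IsFadingTamePast u p →
        ¬ IsTameClassicalShapePreserving ρ u p → ¬ HasOneSidedPressurePast ρ u p → ¬ IsExtinctConservative ρ u p →
        ¬ (ρ = 1 / 2 ∧ IsDSSPowerSpread ρ u) → ¬ IsDSSCompactVorticity ρ u p →
        ¬ IsDSSClassicalTame ρ u p → ¬ (∃ R : E3 ≃ₗᵢ[ℝ] E3, IsDSSClassicalTame ρ (fun τ x => R (u τ (R.symm x))) (fun τ x => p τ (R.symm x))) → ¬ IsDSSClassicalEnergy ρ u p → ¬ IsClassicalVorticityTame u p → ¬ IsSymmetricWeak u H →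
        ¬ IsWeakFluxTame u p H → ¬ IsClassicalConcentrating ρ u p →
        Function.uncurry u =ᵐ[volume.restrict (Set.Iio (0 : ℝ) ×ˢ (Set.univ : Set E3))] 0

/-- Shorthand for the common conclusion «`u = 0` a.e. on `(−∞,0) × ℝ³`». -/
@[reducible] def VanishesAE (u : ℝ → E3 → E3) : Prop :=
  Function.uncurry u =ᵐ[volume.restrict (Set.Iio (0 : ℝ) ×ˢ (Set.univ : Set E3))] 0

/-! ## The new stratum and the line's interface -/

/-- The marked CASIMIR BLOB at time `t₀`: points of the closed ball `B̄(0,R₀)` where the ledger density is at least `λ`, written without division as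
`λ · r ≤ ‖curl u(t₀)‖` (swirl-free: `‖curl u‖ = |ω_θ| = |η| r`; axis points are included harmlessly, a null set). -/
def ledgerBlob (u : ℝ → E3 → E3) (t₀ lam R₀ : ℝ) : Set E3 :=
  {x : E3 | x ∈ Metric.closedBall (0 : E3) R₀ ∧
    lam * Literature.Analysis.FluidPDE.cylRadius x ≤ ‖Literature.Analysis.FluidPDE.curl (u t₀) x‖}

/-- A LEDGER FLOW for `u` on the time-slab `[t₁,t₀]` carrying the marked set `S` with floor `λ`: a jointly continuous family of maps `X s : ℝ³ → ℝ³`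
with `X t₀ = id` on `S`; every trajectory `σ ↦ X σ x` (`x ∈ S`) solves `ẋ = u(σ,x)` on `[t₁,t₀]`; each `X s` is injective on `S`, the images
`X s '' S` are measurable with the volume of `S` and satisfy the change-of-variables identity for `ℝ≥0∞`-valued measurable integrands; the images stay
in one ball; and the LEDGER FLOOR `λ · r ≤ ‖curl u(s)‖` holds along every trajectory from `S` (material conservation of `η = ω_θ/r`). -/
def IsLedgerFlow (u : ℝ → E3 → E3) (lam t₁ t₀ : ℝ) (S : Set E3) (X : ℝ → E3 → E3) : Prop :=
  Continuous (fun q : ℝ × E3 => X q.1 q.2) ∧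
    (∀ x ∈ S, X t₀ x = x) ∧
    (∀ s ∈ Set.Icc t₁ t₀, ∀ x ∈ S, HasDerivWithinAt (fun σ : ℝ => X σ x) (u s (X s x)) (Set.Icc t₁ t₀) s) ∧
    (∀ s ∈ Set.Icc t₁ t₀, Set.InjOn (X s) S) ∧
    (∀ s ∈ Set.Icc t₁ t₀, MeasurableSet (X s '' S) ∧ volume (X s '' S) = volume S) ∧
    (∀ s ∈ Set.Icc t₁ t₀, ∀ g : E3 → ℝ≥0∞, Measurable g → ∫⁻ x in X s '' S, g x = ∫⁻ x in S, g (X s x)) ∧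
    (∃ R : ℝ, ∀ s ∈ Set.Icc t₁ t₀, X s '' S ⊆ Metric.ball (0 : E3) R) ∧
    (∀ s ∈ Set.Icc t₁ t₀, ∀ x ∈ S,
      lam * Literature.Analysis.FluidPDE.cylRadius (X s x) ≤ ‖Literature.Analysis.FluidPDE.curl (u s) (X s x)‖)

/-- `u` HAS LEDGER FLOWS: every marked Casimir blob (`t₀ < 0`, `λ > 0`, `R₀ > 0`) is carried by a ledger flow on every past slab `[t₁,t₀]`. -/
def HasLedgerFlows (u : ℝ → E3 → E3) : Prop :=
  ∀ t₀ : ℝ, t₀ < 0 → ∀ t₁ : ℝ, t₁ < t₀ → ∀ lam R₀ : ℝ, 0 < lam → 0 < R₀ →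
    ∃ X : ℝ → E3 → E3, IsLedgerFlow u lam t₁ t₀ (ledgerBlob u t₀ lam R₀) X

/-- PLANAR LOG-POINCARÉ FOR SMALL SETS (2-D Moser–Trudinger corollary): one constant `C` such that for every disc `B_R ⊂ ℝ²`, every `C¹` function `f`
and every measurable `A ⊆ B_R` of positive area, `|⨍_A f − ⨍_{B_R} f|² ≤ C (1 + log(π R²/|A|)) ∫_{B_R} ‖Df‖²`.  (The logarithm is the capacity price of a
small set; it is sharp on discs `A = B_δ`, `log(R/δ)`.) -/
def LogPoincareSmallSets : Prop :=
  ∃ C : ℝ, 0 < C ∧ ∀ R : ℝ, 0 < R → ∀ f : E2 → ℝ, ContDiff ℝ 1 f →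
    ∀ A : Set E2, MeasurableSet A → A ⊆ Metric.ball (0 : E2) R → 0 < volume A →
      |(⨍ x in A, f x) - ⨍ x in Metric.ball (0 : E2) R, f x| ^ 2 ≤
        C * (1 + Real.log (Real.pi * R ^ 2 / (volume A).toReal)) * ∫ x in Metric.ball (0 : E2) R, ‖fderiv ℝ f x‖ ^ 2

/-- The solid cylinder `{r < 2b, |x₃| < b}` (inside the ball `B(0,3b)`), the arena of one hauling step at scale `b`. -/
def solidCyl (b : ℝ) : Set E3 :=
  {x : E3 | Literature.Analysis.FluidPDE.cylRadius x < 2 * b ∧ |x 2| < b}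

/-- The `r²`-MOMENT of a set (about the symmetry axis): `∫_A r²`. -/
def axisMoment (A : Set E3) : ℝ :=
  ∫ x in A, Literature.Analysis.FluidPDE.cylRadius x ^ 2

/-- THE HAULING INEQUALITY (per time slice, scale `b ≥ 1`): for a `C¹` field `v` on `ℝ³`, an axial weight `|w| ≤ 1` and a measurable set `A`
inside the solid cylinder, the weighted AXIAL FLUX of `A` is bounded by the Dirichlet energy of `v` in the cylinder times the CAPACITY FACTOR
`√(M_A (1 + log b + log⁺(b/M_A)))` of the set (`M_A` its `r²`-moment — thin-and-long parcels are cheap only logarithmically, and length inside the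
cylinder is at most `2b`), plus a reference-mean term `√(M_A/b²) ‖v‖_{L²(cyl)}`. -/
def HaulingInequality : Prop :=
  ∃ C : ℝ, 0 < C ∧ ∀ b : ℝ, 1 ≤ b → ∀ v : E3 → E3, ContDiff ℝ 1 v →
    ∀ w : ℝ → ℝ, Measurable w → (∀ z : ℝ, |w z| ≤ 1) →
      ∀ A : Set E3, MeasurableSet A → A ⊆ solidCyl b →
        |∫ x in A, w (x 2) * (v x) 2| ≤
          C * Real.sqrt (∫ x in solidCyl b, ‖fderiv ℝ v x‖ ^ 2) *
              Real.sqrt (axisMoment A * (1 + Real.log b + max 0 (Real.log (b / axisMoment A)))) +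
            C * Real.sqrt (axisMoment A / b ^ 2) * Real.sqrt (∫ x in solidCyl b, ‖v x‖ ^ 2)

/-! ## Registered stubs (sorried) -/

/-- H1 (S/M): members of the haulable stratum HAVE LEDGER FLOWS (Lagrangian transport of the Casimir blob with volume, confinement to a ball and
the ledger floor; re-assembly of `CasimirFloorTransport` with the slab bound in place of the drift envelope). -/
def Sig.stub_ledgerFlow : Prop :=
  ∀ (u : ℝ → E3 → E3) (p : ℝ → E3 → ℝ), IsSlabBoundedSwirlFree u p → HasLedgerFlows u

/-- H1 FILLED BY NAME (REV3): ns-sfl-p1 g10's ★ `CasimirHaul.hasLedgerFlows_of_slabBoundedSwirlFree` (p714362,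
`Theorems/EulerZoomLiouvillePowerGaugeEulerLiouvilleCasimirHaulLedgerFlow.lean`; the statement δ-unfolded, byte-identical). -/
theorem stub_ledgerFlow : Sig.stub_ledgerFlow :=
  Theorems.PowerGaugeEulerLiouville.CasimirHaul.hasLedgerFlows_of_slabBoundedSwirlFree

/-- H2 (M, port): the planar log-Poincaré inequality for small sets [GilbargTrudinger2001 Thm 7.15, Lemma 7.16]. -/
def Sig.stub_logPoincareSmallSets : Prop :=
  LogPoincareSmallSets

/-- H2 FILLED BY NAME (REV4; in REV3 the filler was held back for the farm olean): ns-ezl-w2 g7's ★ `Literature.Analysis.FunctionSpaces.logPoincare_smallSets` (p714183,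
`Literature/Analysis/FunctionSpaces/LogPoincareSmallSets.lean`, `C = 64`; chain `MeanValuePotentialEstimate` → `PlanarRieszKernelBounds` →
`LogPoincareSmallSets`, [GilbargTrudinger2001 L7.12/L7.16/T7.15]). -/
theorem stub_logPoincareSmallSets : Sig.stub_logPoincareSmallSets :=
  Literature.Analysis.FunctionSpaces.logPoincare_smallSets

/-- H3 (M): the planar log-Poincaré inequality implies the HAULING INEQUALITY (Fubini over `x₃`-slices in the solid cylinder, planar bathtub
`|A_z|² ≤ 2π ∫_{A_z} r²`, Cauchy–Schwarz in `z`, Jensen with the concave majorant of `y ↦ y log(1/y)`). -/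
def Sig.stub_haulingInequality : Prop :=
  LogPoincareSmallSets → HaulingInequality

/-- H3 FILLED BY NAME (REV6): ns-ezl-w2 g7's ★ `CasimirHaul.haulingInequality` (UNCONDITIONAL — H2 enters inside as the tree theorem
`logPoincare_smallSets` via `abs_setIntegral_le_slice`; `Theorems/EulerZoomLiouvillePowerGaugeEulerLiouvilleCasimirHaulHaulingInequality.lean` p717413 ACCEPTED 12:10Z, over
`…CasimirHaulSliceEstimate` p714839, `…CasimirHaulSlicing` p715098, `…CasimirHaulSlicingBochner` p715298, `…CasimirHaulHaulingSlices` p717379,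
`Literature/Analysis/FunctionSpaces/PlanarBathtub.lean` p714445 and `…CasimirHaulLogMoment` p714653; the statement is `HaulingInequality` with
`solidCyl`/`axisMoment` δ-unfolded, byte-identical). -/
theorem stub_haulingInequality : Sig.stub_haulingInequality := fun _ =>
  Theorems.PowerGaugeEulerLiouville.CasimirHaul.haulingInequality

/-! ## H4 toolkit -/

section H4Kit

open Literature.Analysis Literature.Analysis.FluidPDE
open Summit.NavierStokesRegularity.NavierStokesRegularity.Theorems.PowerGaugeEulerLiouville

/-- The SHELL at scale `b`: points of `B(0,3b)` at distance `≥ b` from the symmetry axis. -/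
def haulShell (b : ℝ) : Set E3 :=
  {x : E3 | x ∈ Metric.ball (0 : E3) (3 * b) ∧ b ≤ cylRadius x}

/-! ### The blob -/

theorem ledgerBlob_subset_closedBall (u : ℝ → E3 → E3) (t₀ lam R₀ : ℝ) :
    ledgerBlob u t₀ lam R₀ ⊆ Metric.closedBall (0 : E3) R₀ := fun _ hx => hx.1

theorem continuous_curl_slice {u : ℝ → E3 → E3} {p : ℝ → E3 → ℝ}
    (hcl : IsClassicalEulerSolutionOn (Set.Iio 0) 0 u p) {t₀ : ℝ} (ht₀ : t₀ < 0) :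
    Continuous (curl (u t₀)) := by
  have hv : ContDiff ℝ 1 (u t₀) := (hcl.contDiff_velocity (show t₀ ∈ Set.Iio 0 from ht₀)).of_le (by norm_cast)
  rw [curl_eq_curlCLM_comp]
  exact curlCLM.continuous.comp (hv.continuous_fderiv one_ne_zero)

theorem measurableSet_ledgerBlob {u : ℝ → E3 → E3} {p : ℝ → E3 → ℝ}
    (hcl : IsClassicalEulerSolutionOn (Set.Iio 0) 0 u p) {t₀ : ℝ} (ht₀ : t₀ < 0) (lam R₀ : ℝ) :
    MeasurableSet (ledgerBlob u t₀ lam R₀) := by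
  have hc := continuous_curl_slice hcl ht₀
  have h1 : IsClosed (ledgerBlob u t₀ lam R₀) :=
    isClosed_closedBall.inter (isClosed_le (continuous_const.mul continuous_cylRadius) hc.norm)
  exact h1.measurableSet

theorem cylRadius_le_norm₄ (x : E3) : cylRadius x ≤ ‖x‖ := by
  have h1 : cylRadius x ^ 2 ≤ ‖x‖ ^ 2 := by
    rw [cylRadius_sq, EuclideanSpace.norm_sq_eq, Fin.sum_univ_three]
    simp only [Real.norm_eq_abs, sq_abs]
    nlinarith [sq_nonneg (x 2)]
  exact (pow_le_pow_iff_left₀ (cylRadius_nonneg x) (norm_nonneg x) two_ne_zero).1 h1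

/-- If a slice carries vorticity somewhere, some marked Casimir blob (with `λ ≤ 1`) has positive volume. -/
theorem exists_ledgerBlob_pos {u : ℝ → E3 → E3} {p : ℝ → E3 → ℝ}
    (hcl : IsClassicalEulerSolutionOn (Set.Iio 0) 0 u p) {t₀ : ℝ} (ht₀ : t₀ < 0)
    {x₀ : E3} (hx₀ : curl (u t₀) x₀ ≠ 0) :
    ∃ lam R₀ : ℝ, 0 < lam ∧ lam ≤ 1 ∧ 0 < R₀ ∧ 0 < volume (ledgerBlob u t₀ lam R₀) := by
  have hc := continuous_curl_slice hcl ht₀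
  set κ : ℝ := ‖curl (u t₀) x₀‖ with hκdef
  have hκ : 0 < κ := norm_pos_iff.2 hx₀
  -- a ball around `x₀` on which `‖curl‖ > κ/2`
  have hopen : IsOpen {x : E3 | κ / 2 < ‖curl (u t₀) x‖} := isOpen_lt continuous_const hc.norm
  have hx₀mem : x₀ ∈ {x : E3 | κ / 2 < ‖curl (u t₀) x‖} := by
    show κ / 2 < ‖curl (u t₀) x₀‖; rw [← hκdef]; linarith
  obtain ⟨δ, hδ, hball⟩ := Metric.isOpen_iff.1 hopen x₀ hx₀mem
  set R₀ : ℝ := ‖x₀‖ + δ + 1 with hR₀def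
  have hR₀ : 0 < R₀ := by positivity
  set lam : ℝ := min 1 (κ / (2 * R₀)) with hlamdef
  have hlam : 0 < lam := lt_min one_pos (by positivity)
  refine ⟨lam, R₀, hlam, min_le_left _ _, hR₀, ?_⟩
  have hsub : Metric.ball x₀ δ ⊆ ledgerBlob u t₀ lam R₀ := by
    intro x hx
    have hxn : ‖x‖ ≤ ‖x₀‖ + δ := by
      have h1 : dist x x₀ < δ := hx
      rw [dist_eq_norm] at h1
      calc ‖x‖ = ‖(x - x₀) + x₀‖ := by rw [sub_add_cancel]
        _ ≤ ‖x - x₀‖ + ‖x₀‖ := norm_add_le _ _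
        _ ≤ ‖x₀‖ + δ := by linarith
    refine ⟨?_, ?_⟩
    · rw [Metric.mem_closedBall, dist_zero_right]; linarith
    · have hκx : κ / 2 < ‖curl (u t₀) x‖ := hball hx
      have hr : cylRadius x ≤ R₀ := (cylRadius_le_norm₄ x).trans (by linarith)
      have hlamle : lam ≤ κ / (2 * R₀) := min_le_right _ _
      calc lam * cylRadius x ≤ κ / (2 * R₀) * R₀ :=
            mul_le_mul hlamle hr (cylRadius_nonneg x) (by positivity)
        _ = κ / 2 := by field_simp
        _ ≤ ‖curl (u t₀) x‖ := hκx.le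
  exact lt_of_lt_of_le (Metric.measure_ball_pos volume x₀ hδ) (measure_mono hsub)

/-! ### The moment budget (FLOOR + `E`-gauge) -/

/-- Pointwise-in-time FLOOR: along the transported blob `λ² r² ≤ ‖curl u‖² ≤ 16 ‖∇u‖_F²`, so the `r²`-moment of the part of
`X_s(S)` inside any ball is at most `16/λ²` times the Dirichlet integral over that ball. -/
theorem moment_le_frobenius {u : ℝ → E3 → E3} {p : ℝ → E3 → ℝ}
    (hcl : IsClassicalEulerSolutionOn (Set.Iio 0) 0 u p)
    {lam t₁ t₀ : ℝ} (hlam : 0 < lam) {S : Set E3} {X : ℝ → E3 → E3} (hX : IsLedgerFlow u lam t₁ t₀ S X)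
    {s : ℝ} (hs : s ∈ Set.Icc t₁ t₀) (hs0 : s < 0) (a : ℝ) :
    ∫⁻ x in X s '' S ∩ Metric.ball (0 : E3) a, ENNReal.ofReal (cylRadius x ^ 2) ≤
      ENNReal.ofReal (16 / lam ^ 2) * ∫⁻ x in Metric.ball (0 : E3) a, ENNReal.ofReal (frobeniusNormSq (fderiv ℝ (u s) x)) := by
  obtain ⟨-, -, -, -, hmeas, -, -, hfloor⟩ := hX
  have hv : ContDiff ℝ 1 (u s) := (hcl.contDiff_velocity (show s ∈ Set.Iio 0 from hs0)).of_le (by norm_cast)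
  have hFm : Measurable fun x => ENNReal.ofReal (frobeniusNormSq (fderiv ℝ (u s) x)) :=
    (continuous_frobeniusNormSq_fderiv hv one_ne_zero).measurable.ennreal_ofReal
  have hpt : ∀ x ∈ X s '' S ∩ Metric.ball (0 : E3) a,
      ENNReal.ofReal (cylRadius x ^ 2) ≤ ENNReal.ofReal (16 / lam ^ 2) * ENNReal.ofReal (frobeniusNormSq (fderiv ℝ (u s) x)) := by
    rintro x ⟨⟨y, hy, rfl⟩, -⟩
    have h1 := hfloor s hs y hy
    have h2 := SwirlfreeLedger.sq_norm_curl_le_frobeniusNormSq (u s) (X s y)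
    have h3 : (lam * cylRadius (X s y)) ^ 2 ≤ ‖curl (u s) (X s y)‖ ^ 2 :=
      pow_le_pow_left₀ (mul_nonneg hlam.le (cylRadius_nonneg _)) h1 2
    have h4 : cylRadius (X s y) ^ 2 ≤ 16 / lam ^ 2 * frobeniusNormSq (fderiv ℝ (u s) (X s y)) := by
      rw [div_mul_eq_mul_div, le_div_iff₀ (pow_pos hlam 2)]
      nlinarith [h3, h2]
    rw [← ENNReal.ofReal_mul (by positivity)]
    exact ENNReal.ofReal_le_ofReal h4
  calc ∫⁻ x in X s '' S ∩ Metric.ball (0 : E3) a, ENNReal.ofReal (cylRadius x ^ 2)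
      ≤ ∫⁻ x in X s '' S ∩ Metric.ball (0 : E3) a,
          ENNReal.ofReal (16 / lam ^ 2) * ENNReal.ofReal (frobeniusNormSq (fderiv ℝ (u s) x)) :=
        setLIntegral_mono' ((hmeas s hs).1.inter measurableSet_ball) hpt
    _ ≤ ∫⁻ x in Metric.ball (0 : E3) a,
          ENNReal.ofReal (16 / lam ^ 2) * ENNReal.ofReal (frobeniusNormSq (fderiv ℝ (u s) x)) :=
        lintegral_mono_set Set.inter_subset_right
    _ = ENNReal.ofReal (16 / lam ^ 2) * ∫⁻ x in Metric.ball (0 : E3) a, ENNReal.ofReal (frobeniusNormSq (fderiv ℝ (u s) x)) :=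
        lintegral_const_mul _ hFm

/-- The single-scale `E`-budget of a classical member on a window: `∫_{(−a²,0)×B_a} ‖∇u‖_F² ≤ c a^{1−ρ}` (copy of
`SwirlfreeLedger.setLIntegral_window_frobenius_fderiv_le` with the gauge hypothesis at ONE scale). -/
theorem window_frobenius_le {ρ : ℝ} {c : ℝ≥0} {u : ℝ → E3 → E3} {p : ℝ → E3 → ℝ} {H : ℝ → E3 → E3 →L[ℝ] E3}
    (hH : HasWeakSpatialGradientOn (slab (EuclideanSpace ℝ (Fin 3)) (Set.Iio 0) isOpen_Iio) u H)
    (hcl : IsClassicalEulerSolutionOn (Set.Iio 0) 0 u p) {a : ℝ} (ha : 0 < a)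
    (hE : ENNReal.ofReal (a ^ ρ) * cknE a (0 : ℝ × EuclideanSpace ℝ (Fin 3)) H ≤ (c : ℝ≥0∞)) :
    ∫⁻ z in Set.Ioo (-a ^ 2) 0 ×ˢ Metric.ball (0 : E3) a,
        ENNReal.ofReal (frobeniusNormSq (fderiv ℝ (u z.1) z.2)) ≤ ENNReal.ofReal ((c : ℝ) * a ^ (1 - ρ)) := by
  have h1 := TimePeriodic.setLIntegral_window_le_of_gaugeE (H := H) (T := a ^ 2) (R := a) ha le_rfl le_rfl hE
  refine le_trans (le_of_eq ?_) h1
  refine setLIntegral_congr_fun_ae (measurableSet_Ioo.prod measurableSet_ball) ?_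
  have hsub : Set.Ioo (-a ^ 2) 0 ×ˢ Metric.ball (0 : E3) a ⊆ Set.Iio (0 : ℝ) ×ˢ (Set.univ : Set E3) :=
    Set.prod_mono Set.Ioo_subset_Iio_self (Set.subset_univ _)
  have hae := SwirlfreeLedger.weakGradient_ae_eq_fderiv_of_classical hH hcl
  rw [ae_restrict_iff' (measurableSet_Iio.prod MeasurableSet.univ)] at hae
  filter_upwards [hae] with z hz hzQ
  rw [hz (hsub hzQ)]

theorem continuous_frobeniusNormSq_clm : Continuous fun L : E3 →L[ℝ] E3 => frobeniusNormSq L := by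
  unfold frobeniusNormSq
  refine continuous_finsetSum _ fun i _ => ?_
  exact ((ContinuousLinearMap.apply ℝ E3 (stdOrthonormalBasis ℝ E3 i)).continuous.norm).pow 2

/-- MOMENT BUDGET on a window: for a classical member with ledger flow `X` on `[t₁,t₀]`, `(t₁,t₀) ⊆ (−a²,0)`,
`∫_{t₁}^{t₀} ∫_{X_s(S) ∩ B_a} r² ≤ (16/λ²) · c a^{1−ρ}`. -/
theorem moment_budget {ρ : ℝ} {c : ℝ≥0} {u : ℝ → E3 → E3} {p : ℝ → E3 → ℝ} {H : ℝ → E3 → E3 →L[ℝ] E3}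
    (hH : HasWeakSpatialGradientOn (slab (EuclideanSpace ℝ (Fin 3)) (Set.Iio 0) isOpen_Iio) u H)
    (hcl : IsClassicalEulerSolutionOn (Set.Iio 0) 0 u p) {a : ℝ} (ha : 0 < a)
    (hE : ENNReal.ofReal (a ^ ρ) * cknE a (0 : ℝ × EuclideanSpace ℝ (Fin 3)) H ≤ (c : ℝ≥0∞))
    {lam t₁ t₀ : ℝ} (hlam : 0 < lam) (ht₁ : -a ^ 2 ≤ t₁) (ht₀ : t₀ ≤ 0)
    {S : Set E3} {X : ℝ → E3 → E3} (hX : IsLedgerFlow u lam t₁ t₀ S X) :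
    ∫⁻ s in Set.Ioo t₁ t₀, ∫⁻ x in X s '' S ∩ Metric.ball (0 : E3) a, ENNReal.ofReal (cylRadius x ^ 2) ≤
      ENNReal.ofReal (16 / lam ^ 2) * ENNReal.ofReal ((c : ℝ) * a ^ (1 - ρ)) := by
  set I : Set ℝ := Set.Ioo t₁ t₀ with hIdef
  set B : Set E3 := Metric.ball (0 : E3) a with hBdef
  have hI0 : I ⊆ Set.Iio 0 := fun σ hσ => lt_of_lt_of_le hσ.2 ht₀
  have hIW : I ⊆ Set.Ioo (-a ^ 2) 0 := fun σ hσ => ⟨lt_of_le_of_lt ht₁ hσ.1, lt_of_lt_of_le hσ.2 ht₀⟩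
  -- pointwise floor, integrated
  have hstep : ∫⁻ s in I, ∫⁻ x in X s '' S ∩ B, ENNReal.ofReal (cylRadius x ^ 2) ≤
      ∫⁻ s in I, ENNReal.ofReal (16 / lam ^ 2) * ∫⁻ x in B, ENNReal.ofReal (frobeniusNormSq (fderiv ℝ (u s) x)) :=
    setLIntegral_mono' measurableSet_Ioo fun s hs =>
      moment_le_frobenius hcl hlam hX (Set.Ioo_subset_Icc_self hs) (hI0 hs) a
  refine hstep.trans ?_
  rw [lintegral_const_mul' _ _ ENNReal.ofReal_ne_top]
  gcongr ?_ * ?_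
  · exact le_rfl
  -- Tonelli + window budget
  have hD_cont : ContinuousOn (Function.uncurry fun t x => fderiv ℝ (u t) x) (Set.Iio (0 : ℝ) ×ˢ (Set.univ : Set E3)) :=
    (hcl.smooth_velocity.fderiv_slice isOpen_Iio.uniqueDiffOn).continuousOn
  have hG_cont : ContinuousOn (Function.uncurry fun (t : ℝ) (x : E3) => ENNReal.ofReal (frobeniusNormSq (fderiv ℝ (u t) x)))
      (Set.Iio (0 : ℝ) ×ˢ (Set.univ : Set E3)) :=
    ENNReal.continuous_ofReal.comp_continuousOn
      (continuous_frobeniusNormSq_clm.comp_continuousOn hD_cont)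
  have hGi : AEMeasurable (Function.uncurry fun (σ : ℝ) (x : E3) => ENNReal.ofReal (frobeniusNormSq (fderiv ℝ (u σ) x)))
      ((volume.restrict (Set.Ioo (-a ^ 2) 0)).prod (volume.restrict B)) := by
    rw [Measure.prod_restrict, ← Measure.volume_eq_prod]
    exact (hG_cont.mono (Set.prod_mono Set.Ioo_subset_Iio_self (Set.subset_univ _))).aemeasurable
      (measurableSet_Ioo.prod measurableSet_ball)
  calc ∫⁻ s in I, ∫⁻ x in B, ENNReal.ofReal (frobeniusNormSq (fderiv ℝ (u s) x))
      ≤ ∫⁻ s in Set.Ioo (-a ^ 2) 0, ∫⁻ x in B, ENNReal.ofReal (frobeniusNormSq (fderiv ℝ (u s) x)) :=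
        lintegral_mono_set hIW
    _ = ∫⁻ z in Set.Ioo (-a ^ 2) 0 ×ˢ B, ENNReal.ofReal (frobeniusNormSq (fderiv ℝ (u z.1) z.2)) := by
        rw [lintegral_lintegral hGi, Measure.prod_restrict, ← Measure.volume_eq_prod]
    _ ≤ ENNReal.ofReal ((c : ℝ) * a ^ (1 - ρ)) := window_frobenius_le hH hcl ha hE

/-! ### RESIDENCE ⇒ BANISHMENT -/

/-- RESIDENCE ⇒ BANISHMENT: if the window `(t₁,t₀) ⊆ (−9b²,0]` is so long that permanent residence of half of the blob in `B(0,3b)` is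
unaffordable for the moment budget (tube bathtub `|A|²/(96 b) ≤ ∫_A r²`), then at some time of the window less than half of the blob
(in volume) is inside `B(0,3b)`. -/
theorem exists_banished {ρ : ℝ} {c : ℝ≥0} {u : ℝ → E3 → E3} {p : ℝ → E3 → ℝ} {H : ℝ → E3 → E3 →L[ℝ] E3}
    (hH : HasWeakSpatialGradientOn (slab (EuclideanSpace ℝ (Fin 3)) (Set.Iio 0) isOpen_Iio) u H)
    (hcl : IsClassicalEulerSolutionOn (Set.Iio 0) 0 u p) {b : ℝ} (hb : 0 < b)
    (hE : ENNReal.ofReal ((3 * b) ^ ρ) * cknE (3 * b) (0 : ℝ × EuclideanSpace ℝ (Fin 3)) H ≤ (c : ℝ≥0∞))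
    {lam t₁ t₀ : ℝ} (hlam : 0 < lam) (ht₁ : -(3 * b) ^ 2 ≤ t₁) (ht₀ : t₀ ≤ 0)
    {S : Set E3} {X : ℝ → E3 → E3} (hX : IsLedgerFlow u lam t₁ t₀ S X)
    (hrace : 16 / lam ^ 2 * ((c : ℝ) * (3 * b) ^ (1 - ρ)) <
      ((volume S).toReal / 2) ^ 2 / (32 * (3 * b)) * (t₀ - t₁)) :
    ∃ s₁ ∈ Set.Ioo t₁ t₀, volume (X s₁ '' S ∩ Metric.ball (0 : E3) (3 * b)) < volume S / 2 := by
  by_contra hcon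
  simp only [not_exists, not_and, not_lt] at hcon
  have hb3 : 0 < 3 * b := by positivity
  set V : ℝ := (volume S).toReal / 2 with hVdef
  have hV0 : 0 ≤ V := by positivity
  have hmeas := hX.2.2.2.2.1
  have key : ∀ s ∈ Set.Ioo t₁ t₀, ENNReal.ofReal (V ^ 2 / (32 * (3 * b))) ≤
      ∫⁻ x in X s '' S ∩ Metric.ball (0 : E3) (3 * b), ENNReal.ofReal (cylRadius x ^ 2) := by
    intro s hs
    have hsI : s ∈ Set.Icc t₁ t₀ := Set.Ioo_subset_Icc_self hs
    set A : Set E3 := X s '' S ∩ Metric.ball (0 : E3) (3 * b) with hAdef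
    have hA : MeasurableSet A := (hmeas s hsI).1.inter measurableSet_ball
    have hAB : A ⊆ Metric.closedBall (0 : E3) (3 * b) := Set.inter_subset_right.trans Metric.ball_subset_closedBall
    have hbath := NeedleAxisymBand.sq_volume_le_integral_cylRadius_sq hb3 hA hAB
    have hAfin : volume A < ⊤ := (measure_mono hAB).trans_lt measure_closedBall_lt_top
    have hVA : V ≤ (volume A).toReal := by
      have h1 : volume S / 2 ≤ volume A := hcon s hs
      have h2 : (volume S / 2).toReal ≤ (volume A).toReal := ENNReal.toReal_mono hAfin.ne h1
      rw [ENNReal.toReal_div] at h2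
      simpa [hVdef] using h2
    have h3 : V ^ 2 / (32 * (3 * b)) ≤ (volume A).toReal ^ 2 / (32 * (3 * b)) := by gcongr
    have h4 : V ^ 2 / (32 * (3 * b)) ≤ ∫ y in A, cylRadius y ^ 2 := h3.trans hbath
    have hint : IntegrableOn (fun y : E3 => cylRadius y ^ 2) A volume :=
      ((continuous_cylRadius.pow 2).continuousOn.integrableOn_compact
        (isCompact_closedBall (0 : E3) (3 * b))).mono_set hAB
    rw [← ofReal_integral_eq_lintegral_ofReal hint (ae_of_all _ fun y => sq_nonneg _)]
    exact ENNReal.ofReal_le_ofReal h4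
  have hlow : ENNReal.ofReal (V ^ 2 / (32 * (3 * b))) * volume (Set.Ioo t₁ t₀) ≤
      ∫⁻ s in Set.Ioo t₁ t₀, ∫⁻ x in X s '' S ∩ Metric.ball (0 : E3) (3 * b), ENNReal.ofReal (cylRadius x ^ 2) := by
    calc ENNReal.ofReal (V ^ 2 / (32 * (3 * b))) * volume (Set.Ioo t₁ t₀)
        = ∫⁻ _ in Set.Ioo t₁ t₀, ENNReal.ofReal (V ^ 2 / (32 * (3 * b))) := by rw [setLIntegral_const]
      _ ≤ _ := setLIntegral_mono' measurableSet_Ioo key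
  have ht₁' : -(3 * b) ^ 2 ≤ t₁ := ht₁
  have hup := moment_budget hH hcl hb3 hE hlam ht₁' ht₀ hX
  have h := hlow.trans hup
  rw [Real.volume_Ioo, ← ENNReal.ofReal_mul (by positivity), ← ENNReal.ofReal_mul (by positivity)] at h
  have h' := (ENNReal.ofReal_le_ofReal_iff (by positivity)).1 h
  linarith

/-! ### The two H4 sub-stubs and the H4 composition -/

/-- H4a (TRAVEL INEQUALITY, new stub; flow calculus only).  For a slab-bounded classical member, a ledger flow `X` of a measurable blob
`S ⊆ B̄(0,b/4)` on `[t₁,t₀]` and the product cutoff `ψ(x) = ζ(x₃/b)·χ(Px/b)` (`ζ, χ` fixed bumps; `ψ = 1` on `B̄(0,b/4)`, `supp ψ ⊆ B(0,3b)`,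
`supp ∇ψ ⊆ solidCyl b ∪ haulShell b`, `|∇ψ| ≤ K/b`): `|S| = ∫_S ψ∘X_{t₀} = ∫_S ψ∘X_{s₁} + ∫_{s₁}^{t₀} d/ds ∫_S ψ∘X_s`, the rate being
`∫_{X_s S} ∇ψ·u` (FTC along trajectories + Fubini on `S × [s₁,t₀]` + the measure-preserving change of variables of the flow), whose axial part inside
`solidCyl b` is `(K/b)·∫_{X_sS ∩ solidCyl b} w(x₃) u₃` with the fixed profile `w = ζ'/‖ζ'‖_∞` and whose remainder lives in the shell `b ≤ r`, `|x| < 3b`. -/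
def Sig.stub_haulTravel : Prop :=
  ∃ K : ℝ, 0 < K ∧ ∀ b : ℝ, 1 ≤ b →
    ∀ (u : ℝ → E3 → E3) (p : ℝ → E3 → ℝ), IsSlabBoundedSwirlFree u p →
      ∀ lam t₁ t₀ : ℝ, t₁ < t₀ → t₀ < 0 →
        ∀ S : Set E3, MeasurableSet S → S ⊆ Metric.closedBall (0 : E3) (b / 4) →
          ∀ X : ℝ → E3 → E3, IsLedgerFlow u lam t₁ t₀ S X →
            ∃ w : ℝ → ℝ, Measurable w ∧ (∀ z : ℝ, |w z| ≤ 1) ∧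
              ∀ s₁ ∈ Set.Ioo t₁ t₀,
                volume S ≤ volume (X s₁ '' S ∩ Metric.ball (0 : E3) (3 * b)) +
                  ENNReal.ofReal (K / b) *
                    ((∫⁻ s in Set.Ioo t₁ t₀,
                        ‖∫ x in X s '' S ∩ solidCyl b, w (x 2) * (u s x) 2‖ₑ) +
                      ∫⁻ s in Set.Ioo t₁ t₀, ∫⁻ x in X s '' S ∩ haulShell b, ‖u s x‖ₑ)

/-- H4a FILLED BY NAME (REV4): ns-sfl-p1 g10's ★ `CasimirHaul.haulTravel` (p715646 ACCEPTED,
`Theorems/EulerZoomLiouvillePowerGaugeEulerLiouvilleCasimirHaulTravel.lean`, 398 l., on `…CasimirHaulTravelTools` p715141; the statement δ-unfolded,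
byte-identical: product cut-off `ψ = ζ(x₃/b)·χ(r/b)`, FTC along trajectories, Fubini, the flow's change of variables). -/
theorem stub_haulTravel : Sig.stub_haulTravel :=
  Theorems.PowerGaugeEulerLiouville.CasimirHaul.haulTravel

/-- H4c (HAULING BOOKKEEPING; gauges + H3, no flow calculus) — **PROVED in-file below (REV3, `stub_haulBook`), statement unchanged**.  On a window `(t₁,t₀) ⊆ (−9b²,0]` of length `≤ b²`, for a member of the
class with a ledger flow (FLOOR `λ r ≤ |ω|` on `X_s S`): the time-integrated axial flux through `solidCyl b` (bounded per slice by `HaulingInequality`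
with `M_{A_s} ≤ m(s) := ∫_{X_sS ∩ B_{3b}} r² ≤ (16/λ²)∫_{B_{3b}}‖∇u(s)‖²_F`, then Cauchy–Schwarz in time against the `E`-gauge MOMENT BUDGET
`∫ m ≤ 48 c b^{1−ρ₁}/λ²` and `M·L(M) ≤ (2 + 4 log b)·max(m, b⁻²)`, `log b ≤ b^{ρ₁}/ρ₁`) and the shell traffic (`|X_sS ∩ shell| ≤ m(s)/b²`, `A`-gauge
`∫_{B_{3b}}|u(s)|² ≤ 3 c b^{1−2ρ₁}`) are `≤ K_ρ (c+1) b^{1−ρ₁/2}/λ`, `ρ₁ = min ρ 1` (the gauges are used at the single scale `a = 3b ≥ 1`). -/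
def Sig.stub_haulBook : Prop :=
  HaulingInequality → ∀ ρ : ℝ, 0 < ρ → ∃ K : ℝ, 0 < K ∧
    ∀ (u : ℝ → E3 → E3) (p : ℝ → E3 → ℝ) (H : ℝ → E3 → E3 →L[ℝ] E3) (c : ℝ≥0),
      InClass ρ u p H c → IsSlabBoundedSwirlFree u p →
        ∀ lam : ℝ, 0 < lam → lam ≤ 1 → ∀ b : ℝ, 1 ≤ b →
          ∀ t₁ t₀ : ℝ, -(3 * b) ^ 2 ≤ t₁ → t₀ ≤ 0 → t₀ - t₁ ≤ b ^ 2 →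
            ∀ (S : Set E3) (X : ℝ → E3 → E3), IsLedgerFlow u lam t₁ t₀ S X →
              ∀ w : ℝ → ℝ, Measurable w → (∀ z : ℝ, |w z| ≤ 1) →
                (∫⁻ s in Set.Ioo t₁ t₀, ‖∫ x in X s '' S ∩ solidCyl b, w (x 2) * (u s x) 2‖ₑ) +
                    ∫⁻ s in Set.Ioo t₁ t₀, ∫⁻ x in X s '' S ∩ haulShell b, ‖u s x‖ₑ ≤
                  ENNReal.ofReal (K * ((c : ℝ) + 1) * b ^ (1 - min ρ 1 / 2) / lam)

/-! ## H4c toolkit (REV3): the hauling bookkeeping, and H4c PROVED -/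

/-! ### Geometry of the solid cylinder and the shell -/

theorem continuous_coord2 : Continuous fun x : E3 => x 2 :=
  (EuclideanSpace.proj (2 : Fin 3) : E3 →L[ℝ] ℝ).continuous

theorem norm_sq_eq_cylRadius_sq_add (x : E3) : ‖x‖ ^ 2 = cylRadius x ^ 2 + x 2 ^ 2 := by
  rw [cylRadius_sq, EuclideanSpace.norm_sq_eq, Fin.sum_univ_three]
  simp only [Real.norm_eq_abs, sq_abs]

theorem solidCyl_subset_ball {b : ℝ} (hb : 0 < b) : solidCyl b ⊆ Metric.ball (0 : E3) (3 * b) := by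
  intro x hx
  obtain ⟨hr, hz⟩ := hx
  rw [Metric.mem_ball, dist_zero_right]
  have h1 : ‖x‖ ^ 2 < (3 * b) ^ 2 := by
    rw [norm_sq_eq_cylRadius_sq_add]
    have hz2 : x 2 ^ 2 < b ^ 2 := by
      have := abs_lt.1 hz
      nlinarith [this.1, this.2]
    nlinarith [cylRadius_nonneg x, hr, hz2]
  nlinarith [norm_nonneg x, h1]

theorem measurableSet_solidCyl (b : ℝ) : MeasurableSet (solidCyl b) := by
  have h1 : IsOpen (solidCyl b) :=
    (isOpen_lt continuous_cylRadius continuous_const).inter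
      (isOpen_lt (continuous_abs.comp continuous_coord2) continuous_const)
  exact h1.measurableSet

theorem haulShell_subset_ball (b : ℝ) : haulShell b ⊆ Metric.ball (0 : E3) (3 * b) := fun _ hx => hx.1

theorem measurableSet_haulShell (b : ℝ) : MeasurableSet (haulShell b) :=
  measurableSet_ball.inter (measurableSet_le measurable_const continuous_cylRadius.measurable)

/-! ### Elementary real inequalities -/

/-- `M·L(M) ≤ (2 + 4 log b)·(m + b⁻²)` for `0 ≤ M ≤ m`, `b ≥ 1` (the `M log(1/M)` hump is absorbed by the `b⁻²` padding). -/
theorem moment_log_bound {b M m : ℝ} (hb : 1 ≤ b) (hM : 0 ≤ M) (hMm : M ≤ m) :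
    M * (1 + Real.log b + max 0 (Real.log (b / M))) ≤ (2 + 4 * Real.log b) * (m + 1 / b ^ 2) := by
  have hb0 : 0 < b := by linarith
  have hlogb : 0 ≤ Real.log b := Real.log_nonneg hb
  have hm : 0 ≤ m := hM.trans hMm
  have hb2 : 0 < 1 / b ^ 2 := by positivity
  rcases hM.eq_or_lt with hM0 | hMpos
  · rw [← hM0]; simp only [zero_mul]; positivity
  by_cases hcase : 1 / b ^ 2 ≤ M
  · -- `b/M ≤ b³`, so `log⁺(b/M) ≤ 3 log b`
    have h1 : max 0 (Real.log (b / M)) ≤ 3 * Real.log b := by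
      refine max_le (by positivity) ?_
      have hbM : b / M ≤ b ^ 3 := by
        rw [div_le_iff₀ hMpos]
        have : b ^ 3 * (1 / b ^ 2) = b := by field_simp
        nlinarith [this, pow_pos hb0 3]
      calc Real.log (b / M) ≤ Real.log (b ^ 3) := Real.log_le_log (by positivity) hbM
        _ = 3 * Real.log b := by rw [Real.log_pow]; norm_num
    calc M * (1 + Real.log b + max 0 (Real.log (b / M))) ≤ M * (1 + 4 * Real.log b) := by
          apply mul_le_mul_of_nonneg_left _ hM; linarith
      _ ≤ m * (1 + 4 * Real.log b) := by apply mul_le_mul_of_nonneg_right hMm; positivity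
      _ ≤ (2 + 4 * Real.log b) * (m + 1 / b ^ 2) := by nlinarith
  · rw [not_le] at hcase
    -- `M < b⁻² ≤ 1`: `log(b/M) = log b + log(1/M) ≥ 0` and `M log(1/M) ≤ b⁻²(1 + log b²)`
    have hM1 : M ≤ 1 := by
      have : 1 / b ^ 2 ≤ 1 := by rw [div_le_one (by positivity)]; nlinarith
      linarith
    have hlogM : 0 ≤ Real.log (1 / M) := Real.log_nonneg (by rw [le_div_iff₀ hMpos]; linarith)
    have hsplit : Real.log (b / M) = Real.log b + Real.log (1 / M) := by
      rw [← Real.log_mul hb0.ne' (by positivity)]; congr 1; field_simp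
    have hmax : max 0 (Real.log (b / M)) = Real.log b + Real.log (1 / M) := by
      rw [hsplit]; exact max_eq_right (by positivity)
    rw [hmax]
    -- `M log(1/M) ≤ b⁻² + b⁻² log(b²)` via `log x ≤ x - 1`
    have hB : M ≤ 1 / b ^ 2 := hcase.le
    have hkey : M * Real.log (1 / M) ≤ 1 / b ^ 2 + 1 / b ^ 2 * Real.log (b ^ 2) := by
      have h1 : Real.log (1 / M) = Real.log ((1 / b ^ 2) / M) + Real.log (b ^ 2) := by
        rw [← Real.log_mul (by positivity) (by positivity)]; congr 1; field_simp
      rw [h1, mul_add]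
      have h2 : M * Real.log ((1 / b ^ 2) / M) ≤ 1 / b ^ 2 := by
        have h3 : Real.log ((1 / b ^ 2) / M) ≤ (1 / b ^ 2) / M - 1 := Real.log_le_sub_one_of_pos (by positivity)
        calc M * Real.log ((1 / b ^ 2) / M) ≤ M * ((1 / b ^ 2) / M - 1) := mul_le_mul_of_nonneg_left h3 hM
          _ = 1 / b ^ 2 - M := by field_simp
          _ ≤ 1 / b ^ 2 := by linarith
      have h4 : M * Real.log (b ^ 2) ≤ 1 / b ^ 2 * Real.log (b ^ 2) :=
        mul_le_mul_of_nonneg_right hB (Real.log_nonneg (by nlinarith))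
      linarith
    have hlogb2 : Real.log (b ^ 2) = 2 * Real.log b := by rw [Real.log_pow]; norm_num
    rw [hlogb2] at hkey
    have h5 : M * (1 + Real.log b + Real.log b) ≤ 1 / b ^ 2 * (1 + 2 * Real.log b) := by
      calc M * (1 + Real.log b + Real.log b) ≤ 1 / b ^ 2 * (1 + Real.log b + Real.log b) :=
            mul_le_mul_of_nonneg_right hB (by positivity)
        _ = 1 / b ^ 2 * (1 + 2 * Real.log b) := by ring
    calc M * (1 + Real.log b + (Real.log b + Real.log (1 / M)))
        = M * (1 + Real.log b + Real.log b) + M * Real.log (1 / M) := by ring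
      _ ≤ 1 / b ^ 2 * (1 + 2 * Real.log b) + (1 / b ^ 2 + 1 / b ^ 2 * (2 * Real.log b)) := add_le_add h5 hkey
      _ = 1 / b ^ 2 * (2 + 4 * Real.log b) := by ring
      _ ≤ (2 + 4 * Real.log b) * (m + 1 / b ^ 2) := by nlinarith

/-- AM–GM with square roots: `√x·√y ≤ (θ x + y/θ)/2`. -/
theorem sqrt_mul_sqrt_le_amgm {x y θ : ℝ} (hx : 0 ≤ x) (hy : 0 ≤ y) (hθ : 0 < θ) :
    Real.sqrt x * Real.sqrt y ≤ (θ * x + y / θ) / 2 := by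
  have hsx := Real.sq_sqrt hx
  have hsy := Real.sq_sqrt hy
  have h0 : 0 ≤ (θ * Real.sqrt x - Real.sqrt y) ^ 2 := sq_nonneg _
  rw [le_div_iff₀ (by norm_num : (0 : ℝ) < 2)]
  have h1 : Real.sqrt x * Real.sqrt y * 2 * θ ≤ (θ * x + y / θ) * θ := by
    have : (θ * x + y / θ) * θ = θ ^ 2 * x + y := by field_simp
    rw [this]
    nlinarith [Real.sqrt_nonneg x, Real.sqrt_nonneg y]
  exact le_of_mul_le_mul_right h1 hθ

/-- Young: `t ≤ θ/2 + t²/(2θ)`. -/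
theorem le_young {t θ : ℝ} (hθ : 0 < θ) : t ≤ θ / 2 + t ^ 2 / (2 * θ) := by
  have h0 : 0 ≤ (t - θ) ^ 2 := sq_nonneg _
  have h1 : t * (2 * θ) ≤ (θ / 2 + t ^ 2 / (2 * θ)) * (2 * θ) := by
    have : (θ / 2 + t ^ 2 / (2 * θ)) * (2 * θ) = θ ^ 2 + t ^ 2 := by field_simp
    rw [this]; nlinarith
  exact le_of_mul_le_mul_right h1 (by positivity)

/-- The balanced AM–GM value: with `θ = √(X/W)`, `θ y + z/θ ≤ 2√(W X)` whenever `0 ≤ y ≤ W`, `0 ≤ z ≤ X`. -/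
theorem amgm_balanced {W X y z : ℝ} (hW : 0 < W) (hX : 0 < X) (hyW : y ≤ W) (hzX : z ≤ X) :
    Real.sqrt (X / W) * y + z / Real.sqrt (X / W) ≤ 2 * Real.sqrt (W * X) := by
  have hθ : 0 < Real.sqrt (X / W) := Real.sqrt_pos.2 (by positivity)
  have hθW : Real.sqrt (X / W) * W = Real.sqrt (W * X) := by
    rw [show W * X = (X / W) * W ^ 2 by field_simp, Real.sqrt_mul (by positivity), Real.sqrt_sq hW.le]
  have hXθ : X / Real.sqrt (X / W) = Real.sqrt (W * X) := by
    rw [div_eq_iff hθ.ne', ← hθW]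
    have : Real.sqrt (X / W) * Real.sqrt (X / W) = X / W := Real.mul_self_sqrt (by positivity)
    calc X = X / W * W := by field_simp
      _ = Real.sqrt (X / W) * Real.sqrt (X / W) * W := by rw [this]
      _ = Real.sqrt (X / W) * W * Real.sqrt (X / W) := by ring
  have h1 : Real.sqrt (X / W) * y ≤ Real.sqrt (W * X) := by
    rw [← hθW]; exact mul_le_mul_of_nonneg_left hyW hθ.le
  have h2 : z / Real.sqrt (X / W) ≤ Real.sqrt (W * X) := by
    rw [← hXθ]; exact div_le_div_of_nonneg_right hzX hθ.le
  linarith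

/-! ### Per-slice measure lemmas -/

/-- On the shell `r ≥ b`, so `b² |X_sS ∩ shell| ≤ ∫_{X_sS ∩ B_{3b}} r²`. -/
theorem shell_volume_le {u : ℝ → E3 → E3} {lam t₁ t₀ : ℝ} {S : Set E3} {X : ℝ → E3 → E3}
    (hX : IsLedgerFlow u lam t₁ t₀ S X) {b : ℝ} (hb : 0 ≤ b) {s : ℝ} (hs : s ∈ Set.Icc t₁ t₀) :
    ENNReal.ofReal (b ^ 2) * volume (X s '' S ∩ haulShell b) ≤
      ∫⁻ x in X s '' S ∩ Metric.ball (0 : E3) (3 * b), ENNReal.ofReal (cylRadius x ^ 2) := by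
  have hmeas := hX.2.2.2.2.1 s hs
  have hT : MeasurableSet (X s '' S ∩ haulShell b) := hmeas.1.inter (measurableSet_haulShell b)
  calc ENNReal.ofReal (b ^ 2) * volume (X s '' S ∩ haulShell b)
      = ∫⁻ _ in X s '' S ∩ haulShell b, ENNReal.ofReal (b ^ 2) := by rw [setLIntegral_const]
    _ ≤ ∫⁻ x in X s '' S ∩ haulShell b, ENNReal.ofReal (cylRadius x ^ 2) := by
        refine setLIntegral_mono' hT fun x hx => ENNReal.ofReal_le_ofReal ?_
        exact pow_le_pow_left₀ hb hx.2.2 2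
    _ ≤ ∫⁻ x in X s '' S ∩ Metric.ball (0 : E3) (3 * b), ENNReal.ofReal (cylRadius x ^ 2) :=
        lintegral_mono_set (Set.inter_subset_inter_right _ (haulShell_subset_ball b))

/-- Shell traffic by Young: `∫_{T} |u| ≤ (θ/2)|T| + (1/2θ) ∫_{B_{3b}} |u|²`, `T = X_sS ∩ shell`. -/
theorem shell_traffic_le {u : ℝ → E3 → E3} {p : ℝ → E3 → ℝ}
    (hcl : IsClassicalEulerSolutionOn (Set.Iio 0) 0 u p)
    {lam t₁ t₀ : ℝ} {S : Set E3} {X : ℝ → E3 → E3} (hX : IsLedgerFlow u lam t₁ t₀ S X)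
    (b : ℝ) {s : ℝ} (hs : s ∈ Set.Icc t₁ t₀) (hs0 : s < 0) {θ : ℝ} (hθ : 0 < θ) :
    ∫⁻ x in X s '' S ∩ haulShell b, ‖u s x‖ₑ ≤
      ENNReal.ofReal (θ / 2) * volume (X s '' S ∩ haulShell b) +
        ENNReal.ofReal (1 / (2 * θ)) * ∫⁻ x in Metric.ball (0 : E3) (3 * b), ‖u s x‖ₑ ^ 2 := by
  have hmeas := hX.2.2.2.2.1 s hs
  have hT : MeasurableSet (X s '' S ∩ haulShell b) := hmeas.1.inter (measurableSet_haulShell b)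
  have hv : Continuous (u s) := ((hcl.contDiff_velocity (show s ∈ Set.Iio 0 from hs0)).of_le
    (by norm_cast : ((0 : ℕ) : WithTop ℕ∞) ≤ _)).continuous
  have hgm : Measurable fun x => ‖u s x‖ₑ ^ 2 := (hv.measurable.enorm).pow_const 2
  have hpt : ∀ x, ‖u s x‖ₑ ≤ ENNReal.ofReal (θ / 2) + ENNReal.ofReal (1 / (2 * θ)) * ‖u s x‖ₑ ^ 2 := by
    intro x
    have h1 := le_young (t := ‖u s x‖) hθ
    rw [← ofReal_norm, ← ENNReal.ofReal_pow (norm_nonneg _), ← ENNReal.ofReal_mul (by positivity),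
      ← ENNReal.ofReal_add (by positivity) (by positivity)]
    refine ENNReal.ofReal_le_ofReal ?_
    calc ‖u s x‖ ≤ θ / 2 + ‖u s x‖ ^ 2 / (2 * θ) := h1
      _ = θ / 2 + 1 / (2 * θ) * ‖u s x‖ ^ 2 := by ring
  calc ∫⁻ x in X s '' S ∩ haulShell b, ‖u s x‖ₑ
      ≤ ∫⁻ x in X s '' S ∩ haulShell b, (ENNReal.ofReal (θ / 2) + ENNReal.ofReal (1 / (2 * θ)) * ‖u s x‖ₑ ^ 2) :=
        lintegral_mono fun x => hpt x
    _ = ENNReal.ofReal (θ / 2) * volume (X s '' S ∩ haulShell b) +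
          ENNReal.ofReal (1 / (2 * θ)) * ∫⁻ x in X s '' S ∩ haulShell b, ‖u s x‖ₑ ^ 2 := by
        rw [lintegral_add_left (measurable_const), setLIntegral_const, lintegral_const_mul _ hgm]
    _ ≤ ENNReal.ofReal (θ / 2) * volume (X s '' S ∩ haulShell b) +
          ENNReal.ofReal (1 / (2 * θ)) * ∫⁻ x in Metric.ball (0 : E3) (3 * b), ‖u s x‖ₑ ^ 2 := by
        gcongr
        exact Set.inter_subset_right.trans (haulShell_subset_ball b)

/-- The `r²`-moment inside `B_{3b}` of anything is finite. -/
theorem moment_ball_lt_top (A : Set E3) (b : ℝ) :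
    ∫⁻ x in A ∩ Metric.ball (0 : E3) (3 * b), ENNReal.ofReal (cylRadius x ^ 2) < ⊤ := by
  refine lt_of_le_of_lt (lintegral_mono_set Set.inter_subset_right) ?_
  have h1 : ∫⁻ x in Metric.ball (0 : E3) (3 * b), ENNReal.ofReal (cylRadius x ^ 2) ≤
      ∫⁻ _ in Metric.ball (0 : E3) (3 * b), ENNReal.ofReal ((3 * b) ^ 2) := by
    refine setLIntegral_mono' measurableSet_ball fun x hx => ENNReal.ofReal_le_ofReal ?_
    have hxb : ‖x‖ < 3 * b := by simpa using hx
    have := cylRadius_le_norm₄ x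
    nlinarith [cylRadius_nonneg x, norm_nonneg x]
  refine lt_of_le_of_lt h1 ?_
  rw [setLIntegral_const]
  exact ENNReal.mul_lt_top ENNReal.ofReal_lt_top measure_ball_lt_top

/-- A continuous slice has finite `L²` mass on `B_{3b}`. -/
theorem ball_sq_lt_top {v : E3 → E3} (hv : Continuous v) (b : ℝ) :
    ∫⁻ x in Metric.ball (0 : E3) (3 * b), ‖v x‖ₑ ^ 2 < ⊤ := by
  obtain ⟨B, hB⟩ := (isCompact_closedBall (0 : E3) (3 * b)).exists_bound_of_continuousOn hv.continuousOn
  refine lt_of_le_of_lt (lintegral_mono_set Metric.ball_subset_closedBall) ?_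
  have h1 : ∫⁻ x in Metric.closedBall (0 : E3) (3 * b), ‖v x‖ₑ ^ 2 ≤
      ∫⁻ _ in Metric.closedBall (0 : E3) (3 * b), ENNReal.ofReal (B ^ 2) := by
    refine setLIntegral_mono' measurableSet_closedBall fun x hx => ?_
    rw [← ofReal_norm, ← ENNReal.ofReal_pow (norm_nonneg _)]
    exact ENNReal.ofReal_le_ofReal (pow_le_pow_left₀ (norm_nonneg _) (hB x hx) 2)
  refine lt_of_le_of_lt h1 ?_
  rw [setLIntegral_const]
  exact ENNReal.mul_lt_top ENNReal.ofReal_lt_top measure_closedBall_lt_top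


/-! ### The per-slice axial flux bound -/

/-- Per-slice AXIAL FLUX bound: `HaulingInequality` at the slice + `M_A ≤ m(s)` + `M·L(M) ≤ (2+4 log b)(m + b⁻²)` + AM–GM (twice). -/
theorem axial_flux_le {C : ℝ} (hC : 0 < C)
    (hHaul : ∀ b : ℝ, 1 ≤ b → ∀ v : E3 → E3, ContDiff ℝ 1 v →
      ∀ w : ℝ → ℝ, Measurable w → (∀ z : ℝ, |w z| ≤ 1) →
        ∀ A : Set E3, MeasurableSet A → A ⊆ solidCyl b →
          |∫ x in A, w (x 2) * (v x) 2| ≤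
            C * Real.sqrt (∫ x in solidCyl b, ‖fderiv ℝ v x‖ ^ 2) *
                Real.sqrt (axisMoment A * (1 + Real.log b + max 0 (Real.log (b / axisMoment A)))) +
              C * Real.sqrt (axisMoment A / b ^ 2) * Real.sqrt (∫ x in solidCyl b, ‖v x‖ ^ 2))
    {b : ℝ} (hb : 1 ≤ b) {u : ℝ → E3 → E3} {p : ℝ → E3 → ℝ} (hcl : IsClassicalEulerSolutionOn (Set.Iio 0) 0 u p)
    {lam t₁ t₀ : ℝ} {S : Set E3} {X : ℝ → E3 → E3} (hX : IsLedgerFlow u lam t₁ t₀ S X)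
    {w : ℝ → ℝ} (hw : Measurable w) (hw1 : ∀ z : ℝ, |w z| ≤ 1)
    {s : ℝ} (hs : s ∈ Set.Icc t₁ t₀) (hs0 : s < 0) {θ₁ θ₂ : ℝ} (hθ₁ : 0 < θ₁) (hθ₂ : 0 < θ₂) :
    |∫ x in X s '' S ∩ solidCyl b, w (x 2) * (u s x) 2| ≤
      C / 2 * (θ₁ * (∫⁻ x in solidCyl b, ENNReal.ofReal (‖fderiv ℝ (u s) x‖ ^ 2)).toReal +
          (2 + 4 * Real.log b) *
            ((∫⁻ x in X s '' S ∩ Metric.ball (0 : E3) (3 * b), ENNReal.ofReal (cylRadius x ^ 2)).toReal + 1 / b ^ 2) / θ₁) +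
        C / 2 * (θ₂ * ((∫⁻ x in X s '' S ∩ Metric.ball (0 : E3) (3 * b), ENNReal.ofReal (cylRadius x ^ 2)).toReal / b ^ 2) +
          (∫⁻ x in Metric.ball (0 : E3) (3 * b), ‖u s x‖ₑ ^ 2).toReal / θ₂) := by
  have hb0 : 0 < b := by linarith
  set A : Set E3 := X s '' S ∩ solidCyl b with hAdef
  set Dh : ℝ≥0∞ := ∫⁻ x in solidCyl b, ENNReal.ofReal (‖fderiv ℝ (u s) x‖ ^ 2) with hDh
  set mh : ℝ≥0∞ := ∫⁻ x in X s '' S ∩ Metric.ball (0 : E3) (3 * b), ENNReal.ofReal (cylRadius x ^ 2) with hmh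
  set Uh : ℝ≥0∞ := ∫⁻ x in Metric.ball (0 : E3) (3 * b), ‖u s x‖ₑ ^ 2 with hUh
  have hmeas := hX.2.2.2.2.1 s hs
  have hA : MeasurableSet A := hmeas.1.inter (measurableSet_solidCyl b)
  have hAcyl : A ⊆ solidCyl b := Set.inter_subset_right
  have hv : ContDiff ℝ 1 (u s) := (hcl.contDiff_velocity (show s ∈ Set.Iio 0 from hs0)).of_le (by norm_cast)
  have hvc : Continuous (u s) := hv.continuous
  have hDc : Continuous (fderiv ℝ (u s)) := hv.continuous_fderiv one_ne_zero
  have hH := hHaul b hb (u s) hv w hw hw1 A hA hAcyl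
  -- (E1) the Dirichlet integral as a lintegral
  have hE1 : ∫ x in solidCyl b, ‖fderiv ℝ (u s) x‖ ^ 2 = Dh.toReal := by
    rw [hDh]
    exact integral_eq_lintegral_of_nonneg_ae (ae_of_all _ fun x => by positivity) (hDc.norm.pow 2).aestronglyMeasurable
  -- (E2) the axis moment
  set M : ℝ := axisMoment A with hMdef
  have hM0 : 0 ≤ M := integral_nonneg fun x => sq_nonneg _
  have hmh_fin : mh ≠ ⊤ := (moment_ball_lt_top (X s '' S) b).ne
  have hMm : M ≤ mh.toReal := by
    have h1 : M = (∫⁻ x in A, ENNReal.ofReal (cylRadius x ^ 2)).toReal := by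
      rw [hMdef, axisMoment]
      exact integral_eq_lintegral_of_nonneg_ae (ae_of_all _ fun x => sq_nonneg _)
        (continuous_cylRadius.pow 2).aestronglyMeasurable
    rw [h1]
    refine ENNReal.toReal_mono hmh_fin (lintegral_mono_set ?_)
    exact Set.inter_subset_inter_right _ (solidCyl_subset_ball hb0)
  -- (E3) the L² mass
  have hUh_fin : Uh ≠ ⊤ := (ball_sq_lt_top hvc b).ne
  have hU : ∫ x in solidCyl b, ‖u s x‖ ^ 2 ≤ Uh.toReal := by
    have h1 : ∫ x in solidCyl b, ‖u s x‖ ^ 2 = (∫⁻ x in solidCyl b, ENNReal.ofReal (‖u s x‖ ^ 2)).toReal :=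
      integral_eq_lintegral_of_nonneg_ae (ae_of_all _ fun x => by positivity) (hvc.norm.pow 2).aestronglyMeasurable
    rw [h1]
    refine ENNReal.toReal_mono hUh_fin ?_
    calc ∫⁻ x in solidCyl b, ENNReal.ofReal (‖u s x‖ ^ 2) = ∫⁻ x in solidCyl b, ‖u s x‖ₑ ^ 2 := by
          refine lintegral_congr fun x => ?_
          rw [← ofReal_norm, ENNReal.ofReal_pow (norm_nonneg _)]
      _ ≤ Uh := lintegral_mono_set (solidCyl_subset_ball hb0)
  -- the `L`-factor
  have hlogb : 0 ≤ Real.log b := Real.log_nonneg hb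
  have hL0 : 0 ≤ 1 + Real.log b + max 0 (Real.log (b / M)) := by positivity
  have hML : M * (1 + Real.log b + max 0 (Real.log (b / M))) ≤ (2 + 4 * Real.log b) * (mh.toReal + 1 / b ^ 2) :=
    moment_log_bound hb hM0 hMm
  -- first term
  have hT1 : C * Real.sqrt (∫ x in solidCyl b, ‖fderiv ℝ (u s) x‖ ^ 2) *
        Real.sqrt (M * (1 + Real.log b + max 0 (Real.log (b / M)))) ≤
      C / 2 * (θ₁ * Dh.toReal + (2 + 4 * Real.log b) * (mh.toReal + 1 / b ^ 2) / θ₁) := by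
    rw [hE1, mul_assoc]
    have h1 := sqrt_mul_sqrt_le_amgm (x := Dh.toReal) (y := M * (1 + Real.log b + max 0 (Real.log (b / M))))
      ENNReal.toReal_nonneg (by positivity) hθ₁
    have h2 : (θ₁ * Dh.toReal + M * (1 + Real.log b + max 0 (Real.log (b / M))) / θ₁) / 2 ≤
        (θ₁ * Dh.toReal + (2 + 4 * Real.log b) * (mh.toReal + 1 / b ^ 2) / θ₁) / 2 :=
      by have := div_le_div_of_nonneg_right hML hθ₁.le; linarith
    calc C * (Real.sqrt Dh.toReal * Real.sqrt (M * (1 + Real.log b + max 0 (Real.log (b / M)))))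
        ≤ C * ((θ₁ * Dh.toReal + (2 + 4 * Real.log b) * (mh.toReal + 1 / b ^ 2) / θ₁) / 2) :=
          mul_le_mul_of_nonneg_left (h1.trans h2) hC.le
      _ = _ := by ring
  -- second term
  have hT2 : C * Real.sqrt (M / b ^ 2) * Real.sqrt (∫ x in solidCyl b, ‖u s x‖ ^ 2) ≤
      C / 2 * (θ₂ * (mh.toReal / b ^ 2) + Uh.toReal / θ₂) := by
    rw [mul_assoc]
    have h1 : Real.sqrt (M / b ^ 2) ≤ Real.sqrt (mh.toReal / b ^ 2) :=
      Real.sqrt_le_sqrt (div_le_div_of_nonneg_right hMm (by positivity))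
    have h2 : Real.sqrt (∫ x in solidCyl b, ‖u s x‖ ^ 2) ≤ Real.sqrt Uh.toReal := Real.sqrt_le_sqrt hU
    have h3 := sqrt_mul_sqrt_le_amgm (x := mh.toReal / b ^ 2) (y := Uh.toReal) (by positivity) ENNReal.toReal_nonneg hθ₂
    calc C * (Real.sqrt (M / b ^ 2) * Real.sqrt (∫ x in solidCyl b, ‖u s x‖ ^ 2))
        ≤ C * (Real.sqrt (mh.toReal / b ^ 2) * Real.sqrt Uh.toReal) :=
          mul_le_mul_of_nonneg_left (mul_le_mul h1 h2 (Real.sqrt_nonneg _) (Real.sqrt_nonneg _)) hC.le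
      _ ≤ C * ((θ₂ * (mh.toReal / b ^ 2) + Uh.toReal / θ₂) / 2) := mul_le_mul_of_nonneg_left h3 hC.le
      _ = _ := by ring
  exact hH.trans (add_le_add hT1 hT2)


/-! ### Per-slice majorant in `ℝ≥0∞` -/

/-- Per-slice MAJORANT: flux + shell traffic `≤ α·D̂(s) + β·m̂(s) + γ` with the bookkeeping constants of the proof of H4c. -/
theorem slice_majorant {C : ℝ} (hC : 0 < C)
    (hHaul : ∀ b : ℝ, 1 ≤ b → ∀ v : E3 → E3, ContDiff ℝ 1 v →
      ∀ w : ℝ → ℝ, Measurable w → (∀ z : ℝ, |w z| ≤ 1) →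
        ∀ A : Set E3, MeasurableSet A → A ⊆ solidCyl b →
          |∫ x in A, w (x 2) * (v x) 2| ≤
            C * Real.sqrt (∫ x in solidCyl b, ‖fderiv ℝ v x‖ ^ 2) *
                Real.sqrt (axisMoment A * (1 + Real.log b + max 0 (Real.log (b / axisMoment A)))) +
              C * Real.sqrt (axisMoment A / b ^ 2) * Real.sqrt (∫ x in solidCyl b, ‖v x‖ ^ 2))
    {b : ℝ} (hb : 1 ≤ b) {u : ℝ → E3 → E3} {p : ℝ → E3 → ℝ} (hcl : IsClassicalEulerSolutionOn (Set.Iio 0) 0 u p)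
    {lam t₁ t₀ : ℝ} {S : Set E3} {X : ℝ → E3 → E3} (hX : IsLedgerFlow u lam t₁ t₀ S X)
    {w : ℝ → ℝ} (hw : Measurable w) (hw1 : ∀ z : ℝ, |w z| ≤ 1)
    {s : ℝ} (hs : s ∈ Set.Icc t₁ t₀) (hs0 : s < 0)
    {U₀ : ℝ} (hU₀ : 0 ≤ U₀) (hUs : ∫⁻ x in Metric.ball (0 : E3) (3 * b), ‖u s x‖ₑ ^ 2 ≤ ENNReal.ofReal U₀)
    {θ₁ θ₂ θ₃ : ℝ} (hθ₁ : 0 < θ₁) (hθ₂ : 0 < θ₂) (hθ₃ : 0 < θ₃) :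
    ‖∫ x in X s '' S ∩ solidCyl b, w (x 2) * (u s x) 2‖ₑ + ∫⁻ x in X s '' S ∩ haulShell b, ‖u s x‖ₑ ≤
      ENNReal.ofReal (C / 2 * θ₁) * (∫⁻ x in solidCyl b, ENNReal.ofReal (‖fderiv ℝ (u s) x‖ ^ 2)) +
        ENNReal.ofReal (C / 2 * ((2 + 4 * Real.log b) / θ₁) + C / 2 * (θ₂ / b ^ 2) + θ₃ / (2 * b ^ 2)) *
          (∫⁻ x in X s '' S ∩ Metric.ball (0 : E3) (3 * b), ENNReal.ofReal (cylRadius x ^ 2)) +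
        ENNReal.ofReal (C / 2 * ((2 + 4 * Real.log b) / (θ₁ * b ^ 2)) + C / 2 * (U₀ / θ₂) + U₀ / (2 * θ₃)) := by
  have hb0 : 0 < b := by linarith
  set Dh : ℝ≥0∞ := ∫⁻ x in solidCyl b, ENNReal.ofReal (‖fderiv ℝ (u s) x‖ ^ 2) with hDh
  set mh : ℝ≥0∞ := ∫⁻ x in X s '' S ∩ Metric.ball (0 : E3) (3 * b), ENNReal.ofReal (cylRadius x ^ 2) with hmh
  set Uh : ℝ≥0∞ := ∫⁻ x in Metric.ball (0 : E3) (3 * b), ‖u s x‖ₑ ^ 2 with hUh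
  have hlogb : 0 ≤ Real.log b := Real.log_nonneg hb
  set G : ℝ := 2 + 4 * Real.log b with hG
  have hG0 : 0 ≤ G := by positivity
  have hU : Uh.toReal ≤ U₀ := ENNReal.toReal_le_of_le_ofReal hU₀ hUs
  -- the flux
  have hflux := axial_flux_le hC hHaul hb hcl hX hw hw1 hs hs0 hθ₁ hθ₂
  have hflux' : |∫ x in X s '' S ∩ solidCyl b, w (x 2) * (u s x) 2| ≤
      C / 2 * θ₁ * Dh.toReal + (C / 2 * (G / θ₁) + C / 2 * (θ₂ / b ^ 2)) * mh.toReal +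
        (C / 2 * (G / (θ₁ * b ^ 2)) + C / 2 * (U₀ / θ₂)) := by
    refine hflux.trans ?_
    have h1 : C / 2 * (θ₂ * (mh.toReal / b ^ 2) + Uh.toReal / θ₂) ≤ C / 2 * (θ₂ * (mh.toReal / b ^ 2) + U₀ / θ₂) := by
      have := div_le_div_of_nonneg_right hU hθ₂.le
      nlinarith
    have h2 : C / 2 * (θ₁ * Dh.toReal + G * (mh.toReal + 1 / b ^ 2) / θ₁) + C / 2 * (θ₂ * (mh.toReal / b ^ 2) + U₀ / θ₂) =
        C / 2 * θ₁ * Dh.toReal + (C / 2 * (G / θ₁) + C / 2 * (θ₂ / b ^ 2)) * mh.toReal +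
          (C / 2 * (G / (θ₁ * b ^ 2)) + C / 2 * (U₀ / θ₂)) := by
      field_simp
      ring
    linarith
  have hA0 : 0 ≤ C / 2 * θ₁ * Dh.toReal := by positivity
  have hB0 : 0 ≤ (C / 2 * (G / θ₁) + C / 2 * (θ₂ / b ^ 2)) * mh.toReal := by positivity
  have hC0 : 0 ≤ C / 2 * (G / (θ₁ * b ^ 2)) + C / 2 * (U₀ / θ₂) := by positivity
  have hI : ‖∫ x in X s '' S ∩ solidCyl b, w (x 2) * (u s x) 2‖ₑ ≤
      ENNReal.ofReal (C / 2 * θ₁) * Dh + ENNReal.ofReal (C / 2 * (G / θ₁) + C / 2 * (θ₂ / b ^ 2)) * mh +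
        ENNReal.ofReal (C / 2 * (G / (θ₁ * b ^ 2)) + C / 2 * (U₀ / θ₂)) := by
    rw [Real.enorm_eq_ofReal_abs]
    refine (ENNReal.ofReal_le_ofReal hflux').trans ?_
    rw [ENNReal.ofReal_add (add_nonneg hA0 hB0) hC0, ENNReal.ofReal_add hA0 hB0,
      ENNReal.ofReal_mul (by positivity : 0 ≤ C / 2 * θ₁),
      ENNReal.ofReal_mul (by positivity : 0 ≤ C / 2 * (G / θ₁) + C / 2 * (θ₂ / b ^ 2))]
    gcongr
    · exact ENNReal.ofReal_toReal_le
    · exact ENNReal.ofReal_toReal_le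
  -- the shell
  have hT : ∫⁻ x in X s '' S ∩ haulShell b, ‖u s x‖ₑ ≤
      ENNReal.ofReal (θ₃ / (2 * b ^ 2)) * mh + ENNReal.ofReal (U₀ / (2 * θ₃)) := by
    refine (shell_traffic_le hcl hX b hs hs0 hθ₃).trans ?_
    have h1 : ENNReal.ofReal (θ₃ / 2) * volume (X s '' S ∩ haulShell b) ≤ ENNReal.ofReal (θ₃ / (2 * b ^ 2)) * mh := by
      have h2 : ENNReal.ofReal (θ₃ / 2) = ENNReal.ofReal (θ₃ / (2 * b ^ 2)) * ENNReal.ofReal (b ^ 2) := by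
        rw [← ENNReal.ofReal_mul (by positivity)]
        congr 1
        field_simp
      rw [h2, mul_assoc]
      exact mul_le_mul_of_nonneg_left (shell_volume_le hX hb0.le hs) bot_le
    have h3 : ENNReal.ofReal (1 / (2 * θ₃)) * Uh ≤ ENNReal.ofReal (U₀ / (2 * θ₃)) := by
      calc ENNReal.ofReal (1 / (2 * θ₃)) * Uh ≤ ENNReal.ofReal (1 / (2 * θ₃)) * ENNReal.ofReal U₀ :=
            mul_le_mul_of_nonneg_left hUs bot_le
        _ = ENNReal.ofReal (U₀ / (2 * θ₃)) := by
            rw [← ENNReal.ofReal_mul (by positivity)]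
            congr 1
            field_simp
    exact add_le_add h1 h3
  -- sum
  have hβ : ENNReal.ofReal (C / 2 * (G / θ₁) + C / 2 * (θ₂ / b ^ 2)) + ENNReal.ofReal (θ₃ / (2 * b ^ 2)) =
      ENNReal.ofReal (C / 2 * (G / θ₁) + C / 2 * (θ₂ / b ^ 2) + θ₃ / (2 * b ^ 2)) := by
    rw [← ENNReal.ofReal_add (by positivity) (by positivity)]
  have hγ : ENNReal.ofReal (C / 2 * (G / (θ₁ * b ^ 2)) + C / 2 * (U₀ / θ₂)) + ENNReal.ofReal (U₀ / (2 * θ₃)) =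
      ENNReal.ofReal (C / 2 * (G / (θ₁ * b ^ 2)) + C / 2 * (U₀ / θ₂) + U₀ / (2 * θ₃)) := by
    rw [← ENNReal.ofReal_add (by positivity) (by positivity)]
  calc ‖∫ x in X s '' S ∩ solidCyl b, w (x 2) * (u s x) 2‖ₑ + ∫⁻ x in X s '' S ∩ haulShell b, ‖u s x‖ₑ
      ≤ (ENNReal.ofReal (C / 2 * θ₁) * Dh + ENNReal.ofReal (C / 2 * (G / θ₁) + C / 2 * (θ₂ / b ^ 2)) * mh +
          ENNReal.ofReal (C / 2 * (G / (θ₁ * b ^ 2)) + C / 2 * (U₀ / θ₂))) +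
        (ENNReal.ofReal (θ₃ / (2 * b ^ 2)) * mh + ENNReal.ofReal (U₀ / (2 * θ₃))) := add_le_add hI hT
    _ = ENNReal.ofReal (C / 2 * θ₁) * Dh +
          (ENNReal.ofReal (C / 2 * (G / θ₁) + C / 2 * (θ₂ / b ^ 2)) + ENNReal.ofReal (θ₃ / (2 * b ^ 2))) * mh +
        (ENNReal.ofReal (C / 2 * (G / (θ₁ * b ^ 2)) + C / 2 * (U₀ / θ₂)) + ENNReal.ofReal (U₀ / (2 * θ₃))) := by
        ring
    _ = _ := by rw [hβ, hγ]

/-! ### Window budgets -/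

/-- `s ↦ ∫_{solidCyl b} ‖∇u(s)‖²` is a.e.-measurable on a window inside `(−∞,0]`. -/
theorem aemeasurable_cylDirichlet {u : ℝ → E3 → E3} {p : ℝ → E3 → ℝ}
    (hcl : IsClassicalEulerSolutionOn (Set.Iio 0) 0 u p) (b : ℝ) {t₁ t₀ : ℝ} (ht₀ : t₀ ≤ 0) :
    AEMeasurable (fun s => ∫⁻ x in solidCyl b, ENNReal.ofReal (‖fderiv ℝ (u s) x‖ ^ 2))
      (volume.restrict (Set.Ioo t₁ t₀)) := by
  have hD_cont : ContinuousOn (Function.uncurry fun t x => fderiv ℝ (u t) x) (Set.Iio (0 : ℝ) ×ˢ (Set.univ : Set E3)) :=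
    (hcl.smooth_velocity.fderiv_slice isOpen_Iio.uniqueDiffOn).continuousOn
  have hG_cont : ContinuousOn (Function.uncurry fun (t : ℝ) (x : E3) => ENNReal.ofReal (‖fderiv ℝ (u t) x‖ ^ 2))
      (Set.Iio (0 : ℝ) ×ˢ (Set.univ : Set E3)) :=
    ENNReal.continuous_ofReal.comp_continuousOn (hD_cont.norm.pow 2)
  have hGi : AEMeasurable (Function.uncurry fun (σ : ℝ) (x : E3) => ENNReal.ofReal (‖fderiv ℝ (u σ) x‖ ^ 2))
      ((volume.restrict (Set.Ioo t₁ t₀)).prod (volume.restrict (solidCyl b))) := by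
    rw [Measure.prod_restrict, ← Measure.volume_eq_prod]
    exact (hG_cont.mono (Set.prod_mono (fun σ hσ => lt_of_lt_of_le hσ.2 ht₀) (Set.subset_univ _))).aemeasurable
      (measurableSet_Ioo.prod (measurableSet_solidCyl b))
  exact hGi.lintegral_prod_right'

/-- DIRICHLET BUDGET of the solid cylinder on a window `(t₁,t₀) ⊆ (−9b²,0]`: `∫∫_{solidCyl b} ‖∇u‖² ≤ c (3b)^{1−ρ}`. -/
theorem cyl_dirichlet_budget {ρ : ℝ} {c : ℝ≥0} {u : ℝ → E3 → E3} {p : ℝ → E3 → ℝ} {H : ℝ → E3 → E3 →L[ℝ] E3}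
    (hH : HasWeakSpatialGradientOn (slab (EuclideanSpace ℝ (Fin 3)) (Set.Iio 0) isOpen_Iio) u H)
    (hcl : IsClassicalEulerSolutionOn (Set.Iio 0) 0 u p) {b : ℝ} (hb : 0 < b)
    (hE : ENNReal.ofReal ((3 * b) ^ ρ) * cknE (3 * b) (0 : ℝ × EuclideanSpace ℝ (Fin 3)) H ≤ (c : ℝ≥0∞))
    {t₁ t₀ : ℝ} (ht₁ : -(3 * b) ^ 2 ≤ t₁) (ht₀ : t₀ ≤ 0) :
    ∫⁻ s in Set.Ioo t₁ t₀, ∫⁻ x in solidCyl b, ENNReal.ofReal (‖fderiv ℝ (u s) x‖ ^ 2) ≤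
      ENNReal.ofReal ((c : ℝ) * (3 * b) ^ (1 - ρ)) := by
  have ha : (0 : ℝ) < 3 * b := by positivity
  set B : Set E3 := Metric.ball (0 : E3) (3 * b) with hBdef
  have hpt : ∀ s : ℝ, ∫⁻ x in solidCyl b, ENNReal.ofReal (‖fderiv ℝ (u s) x‖ ^ 2) ≤
      ∫⁻ x in B, ENNReal.ofReal (frobeniusNormSq (fderiv ℝ (u s) x)) := fun s =>
    (lintegral_mono_set (solidCyl_subset_ball hb)).trans
      (lintegral_mono fun x => ENNReal.ofReal_le_ofReal (sq_opNorm_le_frobeniusNormSq _))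
  refine (lintegral_mono fun s => hpt s).trans ?_
  have hIW : Set.Ioo t₁ t₀ ⊆ Set.Ioo (-(3 * b) ^ 2) 0 := fun σ hσ => ⟨lt_of_le_of_lt ht₁ hσ.1, lt_of_lt_of_le hσ.2 ht₀⟩
  have hD_cont : ContinuousOn (Function.uncurry fun t x => fderiv ℝ (u t) x) (Set.Iio (0 : ℝ) ×ˢ (Set.univ : Set E3)) :=
    (hcl.smooth_velocity.fderiv_slice isOpen_Iio.uniqueDiffOn).continuousOn
  have hG_cont : ContinuousOn (Function.uncurry fun (t : ℝ) (x : E3) => ENNReal.ofReal (frobeniusNormSq (fderiv ℝ (u t) x)))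
      (Set.Iio (0 : ℝ) ×ˢ (Set.univ : Set E3)) :=
    ENNReal.continuous_ofReal.comp_continuousOn
      (continuous_frobeniusNormSq_clm.comp_continuousOn hD_cont)
  have hGi : AEMeasurable (Function.uncurry fun (σ : ℝ) (x : E3) => ENNReal.ofReal (frobeniusNormSq (fderiv ℝ (u σ) x)))
      ((volume.restrict (Set.Ioo (-(3 * b) ^ 2) 0)).prod (volume.restrict B)) := by
    rw [Measure.prod_restrict, ← Measure.volume_eq_prod]
    exact (hG_cont.mono (Set.prod_mono Set.Ioo_subset_Iio_self (Set.subset_univ _))).aemeasurable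
      (measurableSet_Ioo.prod measurableSet_ball)
  calc ∫⁻ s in Set.Ioo t₁ t₀, ∫⁻ x in B, ENNReal.ofReal (frobeniusNormSq (fderiv ℝ (u s) x))
      ≤ ∫⁻ s in Set.Ioo (-(3 * b) ^ 2) 0, ∫⁻ x in B, ENNReal.ofReal (frobeniusNormSq (fderiv ℝ (u s) x)) :=
        lintegral_mono_set hIW
    _ = ∫⁻ z in Set.Ioo (-(3 * b) ^ 2) 0 ×ˢ B, ENNReal.ofReal (frobeniusNormSq (fderiv ℝ (u z.1) z.2)) := by
        rw [lintegral_lintegral hGi, Measure.prod_restrict, ← Measure.volume_eq_prod]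
    _ ≤ ENNReal.ofReal ((c : ℝ) * (3 * b) ^ (1 - ρ)) := window_frobenius_le hH hcl ha hE


/-! ### The bookkeeping constants (pure real algebra) -/

/-- `(3b)^e ≤ 3 b^{1−ρ₁}` for `b ≥ 1`, `0 ≤ ρ₁`, `e ≤ 1 − ρ₁`. -/
theorem rpow_3b_le {b e ρ₁ : ℝ} (hb : 1 ≤ b) (hρ₁ : 0 ≤ ρ₁) (he : e ≤ 1 - ρ₁) :
    (3 * b) ^ e ≤ 3 * b ^ (1 - ρ₁) := by
  have hb0 : 0 < b := by linarith
  have h3b : (1 : ℝ) ≤ 3 * b := by linarith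
  calc (3 * b) ^ e ≤ (3 * b) ^ (1 - ρ₁) := Real.rpow_le_rpow_of_exponent_le h3b he
    _ = 3 ^ (1 - ρ₁) * b ^ (1 - ρ₁) := Real.mul_rpow (by norm_num) hb0.le
    _ ≤ (3 : ℝ) ^ (1 : ℝ) * b ^ (1 - ρ₁) :=
        mul_le_mul_of_nonneg_right (Real.rpow_le_rpow_of_exponent_le (by norm_num) (by linarith))
          (Real.rpow_nonneg hb0.le _)
    _ = 3 * b ^ (1 - ρ₁) := by rw [Real.rpow_one]

/-- The BOOKKEEPING ALGEBRA of H4c: a choice of the three AM–GM parameters making the integrated majorant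
`≤ K (c+1) b^{1−ρ₁/2}/λ` with `K = 13 C √(2 + 4/ρ₁) + 13 (C+1)`. -/
theorem book_algebra {C ρ lam b cc : ℝ} (hC : 0 < C) (hρ : 0 < ρ) (hlam : 0 < lam) (hlam1 : lam ≤ 1)
    (hb : 1 ≤ b) (hcc : 0 ≤ cc) :
    ∃ θ₁ θ₂ θ₃ : ℝ, 0 < θ₁ ∧ 0 < θ₂ ∧ 0 < θ₃ ∧
      C / 2 * θ₁ * (cc * (3 * b) ^ (1 - ρ)) +
          (C / 2 * ((2 + 4 * Real.log b) / θ₁) + C / 2 * (θ₂ / b ^ 2) + θ₃ / (2 * b ^ 2)) *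
            (16 / lam ^ 2 * (cc * (3 * b) ^ (1 - ρ))) +
          (C / 2 * ((2 + 4 * Real.log b) / (θ₁ * b ^ 2)) + C / 2 * (cc * (3 * b) ^ (1 - 2 * ρ) / θ₂) +
              cc * (3 * b) ^ (1 - 2 * ρ) / (2 * θ₃)) * b ^ 2 ≤
        (13 * C * Real.sqrt (2 + 4 / min ρ 1) + 13 * (C + 1)) * (cc + 1) * b ^ (1 - min ρ 1 / 2) / lam := by
  have hb0 : 0 < b := by linarith
  set ρ₁ : ℝ := min ρ 1 with hρ₁
  have hρ₁0 : 0 < ρ₁ := lt_min hρ (by norm_num)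
  have hρ₁ρ : ρ₁ ≤ ρ := min_le_left _ _
  have hρ₁1 : ρ₁ ≤ 1 := min_le_right _ _
  set G : ℝ := 2 + 4 * Real.log b with hGdef
  set Dr : ℝ := cc * (3 * b) ^ (1 - ρ) with hDr
  set μr : ℝ := 16 / lam ^ 2 * Dr with hμr
  set U₀ : ℝ := cc * (3 * b) ^ (1 - 2 * ρ) with hU₀
  set Z : ℝ := b ^ (1 - ρ₁ / 2) with hZ
  set P : ℝ := b ^ (1 - ρ₁) with hP
  set Q : ℝ := b ^ ρ₁ with hQ
  have hP1 : 1 ≤ P := Real.one_le_rpow hb (by linarith)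
  have hP0 : 0 < P := by linarith
  have hQ1 : 1 ≤ Q := Real.one_le_rpow hb hρ₁0.le
  have hZ0 : 0 < Z := Real.rpow_pos_of_pos hb0 _
  have hPZ : P ≤ Z := Real.rpow_le_rpow_of_exponent_le hb (by linarith)
  -- budgets against `P`
  have h3b : (3 * b) ^ (1 - ρ) ≤ 3 * P := rpow_3b_le hb hρ₁0.le (by linarith)
  have h3b' : (3 * b) ^ (1 - 2 * ρ) ≤ 3 * P := rpow_3b_le hb hρ₁0.le (by linarith)
  have hDr0 : 0 ≤ Dr := by positivity
  have hDrW : Dr ≤ 3 * (cc + 1) * P := by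
    calc Dr ≤ cc * (3 * P) := mul_le_mul_of_nonneg_left h3b hcc
      _ ≤ 3 * (cc + 1) * P := by nlinarith
  have hμr0 : 0 ≤ μr := by positivity
  have hlam2 : lam ^ 2 ≤ 1 := by nlinarith
  have hl2 : 0 < lam ^ 2 := by positivity
  have hμrW : μr ≤ 48 * cc * P / lam ^ 2 := by
    have h1 : μr = 16 * Dr / lam ^ 2 := by rw [hμr]; ring
    rw [h1]
    exact div_le_div_of_nonneg_right (by nlinarith [mul_le_mul_of_nonneg_left h3b hcc]) hl2.le
  have hμr1 : μr + 1 ≤ 49 * (cc + 1) * P / lam ^ 2 := by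
    rw [le_div_iff₀ hl2]
    have h1 : μr * lam ^ 2 ≤ 48 * cc * P := by
      have := hμrW; rwa [le_div_iff₀ hl2] at this
    nlinarith
  have hU₀0 : 0 ≤ U₀ := by positivity
  have hU₀X : U₀ ≤ 3 * (cc + 1) * P := by
    calc U₀ ≤ cc * (3 * P) := mul_le_mul_of_nonneg_left h3b' hcc
      _ ≤ 3 * (cc + 1) * P := by nlinarith
  -- the logarithmic factor
  have hlogb : 0 ≤ Real.log b := Real.log_nonneg hb
  have hG0 : 0 ≤ G := by positivity
  have hGQ : G ≤ (2 + 4 / ρ₁) * Q := by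
    have h1 : Real.log b ≤ Q / ρ₁ := by rw [hQ]; exact Real.log_le_rpow_div hb0.le hρ₁0
    have h2 : (2 + 4 / ρ₁) * Q = 2 * Q + 4 * (Q / ρ₁) := by ring
    rw [h2, hGdef]
    nlinarith
  -- AM–GM data
  set W₁ : ℝ := 3 * (cc + 1) * P with hW₁
  set X₁ : ℝ := (2 + 4 / ρ₁) * Q * (49 * (cc + 1) * P / lam ^ 2) with hX₁
  set W₂ : ℝ := 49 * (cc + 1) * P / lam ^ 2 with hW₂
  set X₂ : ℝ := 3 * (cc + 1) * P with hX₂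
  have hg0 : 0 < 2 + 4 / ρ₁ := by positivity
  have hW₁0 : 0 < W₁ := by positivity
  have hX₁0 : 0 < X₁ := by positivity
  have hW₂0 : 0 < W₂ := by positivity
  have hX₂0 : 0 < X₂ := by positivity
  have hGX : G * (μr + 1) ≤ X₁ := by
    rw [hX₁]; exact mul_le_mul hGQ hμr1 (by positivity) (by positivity)
  have hμrW₂ : μr ≤ W₂ :=
    hμrW.trans (div_le_div_of_nonneg_right (by nlinarith) hl2.le)
  -- choose the parameters
  set φ : ℝ := Real.sqrt (X₂ / W₂) with hφ
  have hφ0 : 0 < φ := Real.sqrt_pos.2 (by positivity)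
  set θ₁ : ℝ := Real.sqrt (X₁ / W₁) with hθ₁
  have hθ₁0 : 0 < θ₁ := Real.sqrt_pos.2 (by positivity)
  refine ⟨θ₁, b ^ 2 * φ, b ^ 2 * φ, hθ₁0, by positivity, by positivity, ?_⟩
  have hθ₁ne : θ₁ ≠ 0 := hθ₁0.ne'
  have hφne : φ ≠ 0 := hφ0.ne'
  have hbne : b ≠ 0 := hb0.ne'
  -- regroup
  have hre : C / 2 * θ₁ * Dr + (C / 2 * (G / θ₁) + C / 2 * (b ^ 2 * φ / b ^ 2) + b ^ 2 * φ / (2 * b ^ 2)) * μr +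
      (C / 2 * (G / (θ₁ * b ^ 2)) + C / 2 * (U₀ / (b ^ 2 * φ)) + U₀ / (2 * (b ^ 2 * φ))) * b ^ 2 =
      C / 2 * (θ₁ * Dr + G * (μr + 1) / θ₁) + C / 2 * (φ * μr + U₀ / φ) + 1 / 2 * (φ * μr + U₀ / φ) := by
    field_simp
    ring
  have hT1 : θ₁ * Dr + G * (μr + 1) / θ₁ ≤ 2 * Real.sqrt (W₁ * X₁) := amgm_balanced hW₁0 hX₁0 hDrW hGX
  have hT2 : φ * μr + U₀ / φ ≤ 2 * Real.sqrt (W₂ * X₂) := amgm_balanced hW₂0 hX₂0 hμrW₂ hU₀X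
  -- evaluate the square roots
  have hPQP : P * Q * P = Z * Z := by
    rw [hP, hQ, hZ, ← Real.rpow_add hb0, ← Real.rpow_add hb0, ← Real.rpow_add hb0]
    congr 1
    ring
  set V : ℝ := (cc + 1) * Z / lam with hV
  have hV0 : 0 ≤ V := by positivity
  have hS1 : Real.sqrt (W₁ * X₁) ≤ 13 * Real.sqrt (2 + 4 / ρ₁) * V := by
    have h1 : W₁ * X₁ = 147 * (2 + 4 / ρ₁) * V ^ 2 := by
      calc W₁ * X₁ = 147 * (2 + 4 / ρ₁) * (cc + 1) ^ 2 / lam ^ 2 * (P * Q * P) := by rw [hW₁, hX₁]; ring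
        _ = 147 * (2 + 4 / ρ₁) * V ^ 2 := by rw [hPQP, hV]; ring
    rw [h1]
    calc Real.sqrt (147 * (2 + 4 / ρ₁) * V ^ 2)
        ≤ Real.sqrt ((13 * Real.sqrt (2 + 4 / ρ₁) * V) ^ 2) := by
          apply Real.sqrt_le_sqrt
          rw [mul_pow, mul_pow, Real.sq_sqrt hg0.le]
          exact mul_le_mul_of_nonneg_right (mul_le_mul_of_nonneg_right (by norm_num) hg0.le) (sq_nonneg V)
      _ = 13 * Real.sqrt (2 + 4 / ρ₁) * V := Real.sqrt_sq (by positivity)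
  have hS2 : Real.sqrt (W₂ * X₂) ≤ 13 * V := by
    have h1 : W₂ * X₂ = 147 * ((cc + 1) * P / lam) ^ 2 := by rw [hW₂, hX₂]; ring
    rw [h1]
    have hV' : (cc + 1) * P / lam ≤ V := by
      rw [hV]; exact div_le_div_of_nonneg_right (mul_le_mul_of_nonneg_left hPZ (by positivity)) hlam.le
    have hV'0 : 0 ≤ (cc + 1) * P / lam := by positivity
    calc Real.sqrt (147 * ((cc + 1) * P / lam) ^ 2) ≤ Real.sqrt ((13 * ((cc + 1) * P / lam)) ^ 2) := by
          apply Real.sqrt_le_sqrt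
          rw [mul_pow]
          exact mul_le_mul_of_nonneg_right (by norm_num) (sq_nonneg _)
      _ = 13 * ((cc + 1) * P / lam) := Real.sqrt_sq (by positivity)
      _ ≤ 13 * V := by linarith
  have e1 : C / 2 * (θ₁ * Dr + G * (μr + 1) / θ₁) ≤ C * (13 * Real.sqrt (2 + 4 / ρ₁) * V) := by
    calc C / 2 * (θ₁ * Dr + G * (μr + 1) / θ₁) ≤ C / 2 * (2 * Real.sqrt (W₁ * X₁)) :=
          mul_le_mul_of_nonneg_left hT1 (by positivity)
      _ ≤ C / 2 * (2 * (13 * Real.sqrt (2 + 4 / ρ₁) * V)) :=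
          mul_le_mul_of_nonneg_left (mul_le_mul_of_nonneg_left hS1 (by norm_num)) (by positivity)
      _ = C * (13 * Real.sqrt (2 + 4 / ρ₁) * V) := by ring
  have e2 : C / 2 * (φ * μr + U₀ / φ) ≤ C * (13 * V) := by
    calc C / 2 * (φ * μr + U₀ / φ) ≤ C / 2 * (2 * Real.sqrt (W₂ * X₂)) :=
          mul_le_mul_of_nonneg_left hT2 (by positivity)
      _ ≤ C / 2 * (2 * (13 * V)) := mul_le_mul_of_nonneg_left (mul_le_mul_of_nonneg_left hS2 (by norm_num)) (by positivity)
      _ = C * (13 * V) := by ring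
  have e3 : 1 / 2 * (φ * μr + U₀ / φ) ≤ 13 * V := by linarith [hT2, hS2]
  have hK : (13 * C * Real.sqrt (2 + 4 / ρ₁) + 13 * (C + 1)) * (cc + 1) * Z / lam =
      C * (13 * Real.sqrt (2 + 4 / ρ₁) * V) + C * (13 * V) + 13 * V := by rw [hV]; ring
  rw [hK]
  linarith [hre, e1, e2, e3]

/-- **H4c `stub_haulBook` PROVED in-file (REV3; statement unchanged).**  The hauling bookkeeping: per slice, `HaulingInequality` (H3) + the Casimir FLOOR moment comparison
`M_{A_s} ≤ m(s)`, `M·L(M) ≤ (2+4 log b)(m(s) + b⁻²)`, the shell estimate `b²|X_sS ∩ shell| ≤ m(s)` with Young, and AM–GM with CONSTANT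
parameters (so that only `s ↦ ∫_{solidCyl b}‖∇u(s)‖²` needs a.e.-measurability, by Tonelli from the joint continuity of `∇u` on the open
past); then the `E`-gauge window budgets (`cyl_dirichlet_budget`, `moment_budget`) and the `A`-gauge slice budget at the single scale `a = 3b`,
and the real algebra `book_algebra` (`log b ≤ b^{ρ₁}/ρ₁`). -/
theorem stub_haulBook : Sig.stub_haulBook := by
  rintro ⟨C, hC, hHaul⟩ ρ hρ
  refine ⟨13 * C * Real.sqrt (2 + 4 / min ρ 1) + 13 * (C + 1), by positivity, ?_⟩
  intro u p H c hcls hsf lam hlam hlam1 b hb t₁ t₀ ht₁ ht₀ hlen S X hX w hw hw1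
  obtain ⟨-, hH, hgauge⟩ := hcls
  have hcl := hsf.1
  have hb0 : 0 < b := by linarith
  have ha : (0 : ℝ) < 3 * b := by positivity
  have hg := hgauge (3 * b) ha
  have hA : ENNReal.ofReal ((3 * b) ^ (2 * ρ)) * cknA (3 * b) (0 : ℝ × EuclideanSpace ℝ (Fin 3)) u ≤ (c : ℝ≥0∞) :=
    (le_self_add.trans le_self_add).trans hg
  have hE : ENNReal.ofReal ((3 * b) ^ ρ) * cknE (3 * b) (0 : ℝ × EuclideanSpace ℝ (Fin 3)) H ≤ (c : ℝ≥0∞) :=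
    (le_add_self.trans le_self_add).trans hg
  obtain ⟨θ₁, θ₂, θ₃, hθ₁, hθ₂, hθ₃, halg⟩ := book_algebra (cc := (c : ℝ)) hC hρ hlam hlam1 hb c.coe_nonneg
  have hlogb : 0 ≤ Real.log b := Real.log_nonneg hb
  set U₀ : ℝ := (c : ℝ) * (3 * b) ^ (1 - 2 * ρ) with hU₀
  have hU₀0 : 0 ≤ U₀ := by positivity
  set G : ℝ := 2 + 4 * Real.log b with hGdef
  set α : ℝ := C / 2 * θ₁ with hα
  set β : ℝ := C / 2 * (G / θ₁) + C / 2 * (θ₂ / b ^ 2) + θ₃ / (2 * b ^ 2) with hβ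
  set γ : ℝ := C / 2 * (G / (θ₁ * b ^ 2)) + C / 2 * (U₀ / θ₂) + U₀ / (2 * θ₃) with hγ
  have hα0 : 0 ≤ α := by positivity
  have hβ0 : 0 ≤ β := by positivity
  have hγ0 : 0 ≤ γ := by positivity
  set Dh : ℝ → ℝ≥0∞ := fun s => ∫⁻ x in solidCyl b, ENNReal.ofReal (‖fderiv ℝ (u s) x‖ ^ 2) with hDh
  set mh : ℝ → ℝ≥0∞ := fun s => ∫⁻ x in X s '' S ∩ Metric.ball (0 : E3) (3 * b), ENNReal.ofReal (cylRadius x ^ 2)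
    with hmh
  -- per slice
  have hslice : ∀ s ∈ Set.Ioo t₁ t₀,
      ‖∫ x in X s '' S ∩ solidCyl b, w (x 2) * (u s x) 2‖ₑ + ∫⁻ x in X s '' S ∩ haulShell b, ‖u s x‖ₑ ≤
        ENNReal.ofReal α * Dh s + ENNReal.ofReal β * mh s + ENNReal.ofReal γ := by
    intro s hs
    have hs0 : s < 0 := lt_of_lt_of_le hs.2 ht₀
    have hsW : s ∈ Set.Ioo (-((3 * b) ^ 2)) 0 := ⟨by linarith [hs.1], hs0⟩
    have hUs := Backward.lintegral_ball_le_of_gaugeA ha hA hsW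
    exact slice_majorant hC hHaul hb hcl hX hw hw1 (Set.Ioo_subset_Icc_self hs) hs0 hU₀0 hUs hθ₁ hθ₂ hθ₃
  -- integrate
  have hDae : AEMeasurable Dh (volume.restrict (Set.Ioo t₁ t₀)) := aemeasurable_cylDirichlet hcl b ht₀
  have hDint : ∫⁻ s in Set.Ioo t₁ t₀, Dh s ≤ ENNReal.ofReal ((c : ℝ) * (3 * b) ^ (1 - ρ)) :=
    cyl_dirichlet_budget hH hcl hb0 hE ht₁ ht₀
  have hmint : ∫⁻ s in Set.Ioo t₁ t₀, mh s ≤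
      ENNReal.ofReal (16 / lam ^ 2) * ENNReal.ofReal ((c : ℝ) * (3 * b) ^ (1 - ρ)) :=
    moment_budget hH hcl ha hE hlam ht₁ ht₀ hX
  have hvol : volume (Set.Ioo t₁ t₀) ≤ ENNReal.ofReal (b ^ 2) := by
    rw [Real.volume_Ioo]; exact ENNReal.ofReal_le_ofReal (by linarith)
  calc (∫⁻ s in Set.Ioo t₁ t₀, ‖∫ x in X s '' S ∩ solidCyl b, w (x 2) * (u s x) 2‖ₑ) +
        ∫⁻ s in Set.Ioo t₁ t₀, ∫⁻ x in X s '' S ∩ haulShell b, ‖u s x‖ₑ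
      ≤ ∫⁻ s in Set.Ioo t₁ t₀, (‖∫ x in X s '' S ∩ solidCyl b, w (x 2) * (u s x) 2‖ₑ +
          ∫⁻ x in X s '' S ∩ haulShell b, ‖u s x‖ₑ) := le_lintegral_add _ _
    _ ≤ ∫⁻ s in Set.Ioo t₁ t₀, (ENNReal.ofReal α * Dh s + ENNReal.ofReal β * mh s + ENNReal.ofReal γ) :=
        setLIntegral_mono' measurableSet_Ioo hslice
    _ = ENNReal.ofReal α * (∫⁻ s in Set.Ioo t₁ t₀, Dh s) + ENNReal.ofReal β * (∫⁻ s in Set.Ioo t₁ t₀, mh s) +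
          ENNReal.ofReal γ * volume (Set.Ioo t₁ t₀) := by
        rw [lintegral_add_right _ measurable_const, lintegral_add_left' (hDae.const_mul _),
          lintegral_const_mul' _ _ ENNReal.ofReal_ne_top, lintegral_const_mul' _ _ ENNReal.ofReal_ne_top,
          setLIntegral_const]
    _ ≤ ENNReal.ofReal α * ENNReal.ofReal ((c : ℝ) * (3 * b) ^ (1 - ρ)) +
          ENNReal.ofReal β * (ENNReal.ofReal (16 / lam ^ 2) * ENNReal.ofReal ((c : ℝ) * (3 * b) ^ (1 - ρ))) +
          ENNReal.ofReal γ * ENNReal.ofReal (b ^ 2) := by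
        gcongr
    _ = ENNReal.ofReal (α * ((c : ℝ) * (3 * b) ^ (1 - ρ)) + β * (16 / lam ^ 2 * ((c : ℝ) * (3 * b) ^ (1 - ρ))) +
          γ * b ^ 2) := by
        rw [← ENNReal.ofReal_mul (by positivity : (0 : ℝ) ≤ 16 / lam ^ 2), ← ENNReal.ofReal_mul hα0,
          ← ENNReal.ofReal_mul hβ0, ← ENNReal.ofReal_mul hγ0,
          ← ENNReal.ofReal_add (by positivity) (by positivity), ← ENNReal.ofReal_add (by positivity) (by positivity)]
    _ ≤ _ := ENNReal.ofReal_le_ofReal halg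

/-- H4 (THE HAUL RACE) — **PROVED in-file (REV2) from H4a `stub_haulTravel` + H4c `stub_haulBook`** and the proved blob / MOMENT-BUDGET /
RESIDENCE⇒BANISHMENT lemmas of the H4 toolkit above (`haulRace_of`): given the hauling inequality, a member of Seregin's class (ANY `ρ > 0`) in the
haulable stratum with ledger flows has IRROTATIONAL slices.  Race: blob `S = ledgerBlob u τ λ R₀` of volume `v > 0` (`exists_ledgerBlob_pos`); scale
`b ≥ max(1, 4R₀, −τ)` with `b^{ρ₁} > 18432(c+1)/(λ²v²)` and `b^{ρ₁/2} > 4 K_a K_c (c+1)/(λ v)` (`ρ₁ = min ρ 1`); window `(τ − b², τ) ⊆ (−9b², 0)`;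
BANISHMENT (`exists_banished`: tube bathtub `NeedleAxisymBand.sq_volume_le_integral_cylRadius_sq` against the moment budget `moment_budget` =
FLOOR `λ²r² ≤ |ω|² ≤ 16‖∇u‖²_F` + the single-scale `E`-gauge `TimePeriodic.setLIntegral_window_le_of_gaugeE`) gives `s₁` with `|X_{s₁}S ∩ B_{3b}| < |S|/2`;
TRAVEL (H4a) + BOOKKEEPING (H4c) give `|S| ≤ |X_{s₁}S ∩ B_{3b}| + K_aK_c(c+1)b^{−ρ₁/2}/λ ≤ |S|/2 + |S|/4`, absurd.  (Statement unchanged.) -/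
def Sig.stub_haulRace : Prop :=
  HaulingInequality →
    ∀ ρ : ℝ, 0 < ρ → ∀ (u : ℝ → E3 → E3) (p : ℝ → E3 → ℝ) (H : ℝ → E3 → E3 →L[ℝ] E3) (c : ℝ≥0),
      InClass ρ u p H c → IsSlabBoundedSwirlFree u p → HasLedgerFlows u →
        ∀ τ : ℝ, τ < 0 → ∀ x : E3, Literature.Analysis.FluidPDE.curl (u τ) x = 0

/-- `(3b)^{1−ρ} ≤ 3 b^{1−ρ₁}` for `b ≥ 1`, `ρ₁ = min ρ 1`. -/
theorem three_b_rpow_le {b ρ : ℝ} (hb : 1 ≤ b) (hρ : 0 < ρ) : (3 * b) ^ (1 - ρ) ≤ 3 * b ^ (1 - min ρ 1) := by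
  have hb0 : 0 < b := by linarith
  have h3b : (1 : ℝ) ≤ 3 * b := by linarith
  have hρ₁ : 0 ≤ min ρ 1 := le_min hρ.le zero_le_one
  calc (3 * b) ^ (1 - ρ) ≤ (3 * b) ^ (1 - min ρ 1) :=
        Real.rpow_le_rpow_of_exponent_le h3b (by linarith [min_le_left ρ 1])
    _ = 3 ^ (1 - min ρ 1) * b ^ (1 - min ρ 1) := Real.mul_rpow (by norm_num) hb0.le
    _ ≤ 3 ^ (1 : ℝ) * b ^ (1 - min ρ 1) :=
        mul_le_mul_of_nonneg_right (Real.rpow_le_rpow_of_exponent_le (by norm_num : (1 : ℝ) ≤ 3) (by linarith))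
          (by positivity)
    _ = 3 * b ^ (1 - min ρ 1) := by rw [Real.rpow_one]

/-- H4 PROVED from H4a + H4c (+ the proved RESIDENCE/BANISHMENT and blob lemmas): the exponent race. -/
theorem haulRace_of (hT : Sig.stub_haulTravel) (hB : Sig.stub_haulBook) : Sig.stub_haulRace := by
  intro hHI ρ hρ u p H c hcls hstr hfl τ hτ x₀
  by_contra hne
  obtain ⟨Ka, hKa, hTrav⟩ := hT
  obtain ⟨Kb, hKb, hBook⟩ := hB hHI ρ hρ
  have hcl : IsClassicalEulerSolutionOn (Set.Iio 0) 0 u p := hstr.1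
  have hH := hcls.2.1
  have hgauge := hcls.2.2
  obtain ⟨lam, R₀, hlam, hlam1, hR₀, hvol⟩ := exists_ledgerBlob_pos hcl hτ hne
  set S : Set E3 := ledgerBlob u τ lam R₀ with hSdef
  have hSmeas : MeasurableSet S := measurableSet_ledgerBlob hcl hτ lam R₀
  have hSsub : S ⊆ Metric.closedBall (0 : E3) R₀ := ledgerBlob_subset_closedBall u τ lam R₀
  have hSfin : volume S < ⊤ := (measure_mono hSsub).trans_lt measure_closedBall_lt_top
  set v : ℝ := (volume S).toReal with hvdef
  have hv : 0 < v := ENNReal.toReal_pos hvol.ne' hSfin.ne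
  set ρ₁ : ℝ := min ρ 1 with hρ₁def
  have hρ₁ : 0 < ρ₁ := lt_min hρ one_pos
  have hρ₁1 : ρ₁ ≤ 1 := min_le_right _ _
  -- the scale `b`
  set Q₁ : ℝ := 18432 * ((c : ℝ) + 1) / (lam ^ 2 * v ^ 2) with hQ₁def
  set Q₂ : ℝ := 4 * Ka * Kb * ((c : ℝ) + 1) / (lam * v) with hQ₂def
  have hQ₁ : 0 < Q₁ := by positivity
  have hQ₂ : 0 < Q₂ := by positivity
  set b : ℝ := max (max 1 (max (4 * R₀) (-τ))) (max (Q₁ ^ ρ₁⁻¹ + 1) (Q₂ ^ (ρ₁ / 2)⁻¹ + 1)) with hbdef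
  have hb1 : 1 ≤ b := le_trans (le_max_left _ _) (le_max_left _ _)
  have hb0 : 0 < b := by linarith
  have hbR : 4 * R₀ ≤ b := le_trans (le_trans (le_max_left _ _) (le_max_right _ _)) (le_max_left _ _)
  have hbτ : -τ ≤ b := le_trans (le_trans (le_max_right _ _) (le_max_right _ _)) (le_max_left _ _)
  have hbQ₁ : Q₁ ^ ρ₁⁻¹ < b :=
    lt_of_lt_of_le (by linarith) (le_trans (le_max_left _ _) (le_max_right _ _))
  have hbQ₂ : Q₂ ^ (ρ₁ / 2)⁻¹ < b :=
    lt_of_lt_of_le (by linarith) (le_trans (le_max_right _ _) (le_max_right _ _))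
  have hQ₁b : Q₁ < b ^ ρ₁ := by
    calc Q₁ = (Q₁ ^ ρ₁⁻¹) ^ ρ₁ := (Real.rpow_inv_rpow hQ₁.le hρ₁.ne').symm
      _ < b ^ ρ₁ := Real.rpow_lt_rpow (by positivity) hbQ₁ hρ₁
  have hQ₂b : Q₂ < b ^ (ρ₁ / 2) := by
    calc Q₂ = (Q₂ ^ (ρ₁ / 2)⁻¹) ^ (ρ₁ / 2) := (Real.rpow_inv_rpow hQ₂.le (by positivity)).symm
      _ < b ^ (ρ₁ / 2) := Real.rpow_lt_rpow (by positivity) hbQ₂ (by positivity)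
  -- the window and the flow
  set t₁ : ℝ := τ - b ^ 2 with ht₁def
  have hb2 : 0 < b ^ 2 := by positivity
  have ht₁τ : t₁ < τ := by rw [ht₁def]; linarith
  have ht₁w : -(3 * b) ^ 2 ≤ t₁ := by rw [ht₁def]; nlinarith
  obtain ⟨X, hX⟩ := hfl τ hτ t₁ ht₁τ lam R₀ hlam hR₀
  -- RESIDENCE ⇒ BANISHMENT at some `s₁`
  have hE3b : ENNReal.ofReal ((3 * b) ^ ρ) * cknE (3 * b) (0 : ℝ × EuclideanSpace ℝ (Fin 3)) H ≤ (c : ℝ≥0∞) :=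
    le_trans (le_trans le_add_self le_self_add) (hgauge (3 * b) (by positivity))
  have hrace : 16 / lam ^ 2 * ((c : ℝ) * (3 * b) ^ (1 - ρ)) < (v / 2) ^ 2 / (32 * (3 * b)) * (τ - t₁) := by
    have hτt : τ - t₁ = b ^ 2 := by rw [ht₁def]; ring
    rw [hτt]
    have h3 := three_b_rpow_le hb1 hρ
    have hc0 : (0 : ℝ) ≤ c := c.2
    have hstep1 : 16 / lam ^ 2 * ((c : ℝ) * (3 * b) ^ (1 - ρ)) ≤ 48 * ((c : ℝ) + 1) * b ^ (1 - ρ₁) / lam ^ 2 := by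
      rw [div_mul_eq_mul_div, div_le_div_iff_of_pos_right (by positivity)]
      have : (c : ℝ) * (3 * b) ^ (1 - ρ) ≤ ((c : ℝ) + 1) * (3 * b ^ (1 - ρ₁)) :=
        mul_le_mul (by linarith) h3 (by positivity) (by positivity)
      nlinarith
    refine lt_of_le_of_lt hstep1 ?_
    -- `48 (c+1) b^{1−ρ₁}/λ² < v² b/384` ⇔ `18432 (c+1)/(λ² v²) < b^{ρ₁}`
    have hbsplit : b ^ (1 - ρ₁) = b / b ^ ρ₁ := by
      rw [Real.rpow_sub hb0, Real.rpow_one]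
    rw [hbsplit]
    have hbρ : 0 < b ^ ρ₁ := Real.rpow_pos_of_pos hb0 _
    have hkey : 18432 * ((c : ℝ) + 1) < lam ^ 2 * v ^ 2 * b ^ ρ₁ := by
      have := hQ₁b
      rw [hQ₁def, div_lt_iff₀ (by positivity)] at this
      exact lt_of_lt_of_eq this (mul_comm _ _)
    rw [div_lt_iff₀ (by positivity)]
    rw [show (v / 2) ^ 2 / (32 * (3 * b)) * b ^ 2 * lam ^ 2 = lam ^ 2 * v ^ 2 * b / 384 by
      field_simp; ring]
    rw [lt_div_iff₀ (by norm_num : (0 : ℝ) < 384)]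
    calc 48 * ((c : ℝ) + 1) * (b / b ^ ρ₁) * 384 = 18432 * ((c : ℝ) + 1) * b / b ^ ρ₁ := by ring
      _ < lam ^ 2 * v ^ 2 * b ^ ρ₁ * b / b ^ ρ₁ := by
          rw [div_lt_div_iff_of_pos_right hbρ]
          exact mul_lt_mul_of_pos_right hkey hb0
      _ = lam ^ 2 * v ^ 2 * b := by field_simp
  obtain ⟨s₁, hs₁, hban⟩ := exists_banished hH hcl hb0 hE3b hlam ht₁w hτ.le hX hrace
  -- TRAVEL and BOOKKEEPING
  have hSsub' : S ⊆ Metric.closedBall (0 : E3) (b / 4) :=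
    hSsub.trans (Metric.closedBall_subset_closedBall (by linarith))
  obtain ⟨w, hw, hw1, htrav⟩ := hTrav b hb1 u p hstr lam t₁ τ ht₁τ hτ S hSmeas hSsub' X hX
  have h1 := htrav s₁ hs₁
  have h2 := hBook u p H c hcls hstr lam hlam hlam1 b hb1 t₁ τ ht₁w hτ.le (by rw [ht₁def]; linarith) S X hX w hw hw1
  have h12 : volume S ≤ volume (X s₁ '' S ∩ Metric.ball (0 : E3) (3 * b)) +
      ENNReal.ofReal (Ka / b) * ENNReal.ofReal (Kb * ((c : ℝ) + 1) * b ^ (1 - min ρ 1 / 2) / lam) := by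
    calc volume S ≤ _ := h1
      _ ≤ _ := by gcongr
  rw [← ENNReal.ofReal_mul (by positivity)] at h12
  have hsmall : Ka / b * (Kb * ((c : ℝ) + 1) * b ^ (1 - min ρ 1 / 2) / lam) ≤ v / 4 := by
    rw [← hρ₁def]
    have hbpow : b ^ (1 - ρ₁ / 2) = b / b ^ (ρ₁ / 2) := by rw [Real.rpow_sub hb0, Real.rpow_one]
    rw [hbpow]
    have hpos : 0 < b ^ (ρ₁ / 2) := Real.rpow_pos_of_pos hb0 _
    have hkey : 4 * Ka * Kb * ((c : ℝ) + 1) < lam * v * b ^ (ρ₁ / 2) := by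
      have := hQ₂b
      rw [hQ₂def, div_lt_iff₀ (by positivity)] at this
      exact lt_of_lt_of_eq this (mul_comm _ _)
    rw [show Ka / b * (Kb * ((c : ℝ) + 1) * (b / b ^ (ρ₁ / 2)) / lam) = Ka * Kb * ((c : ℝ) + 1) / (lam * b ^ (ρ₁ / 2)) by
      field_simp]
    rw [div_le_iff₀ (by positivity)]
    nlinarith
  have hlt : volume S < volume S / 2 + ENNReal.ofReal (v / 4) := by
    calc volume S ≤ volume (X s₁ '' S ∩ Metric.ball (0 : E3) (3 * b)) +
          ENNReal.ofReal (Ka / b * (Kb * ((c : ℝ) + 1) * b ^ (1 - min ρ 1 / 2) / lam)) := h12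
      _ ≤ volume (X s₁ '' S ∩ Metric.ball (0 : E3) (3 * b)) + ENNReal.ofReal (v / 4) := by
          gcongr
      _ < volume S / 2 + ENNReal.ofReal (v / 4) := ENNReal.add_lt_add_right ENNReal.ofReal_ne_top hban
  have hhalf : volume S / 2 ≠ ⊤ := ENNReal.div_ne_top hSfin.ne two_ne_zero
  have hfin2 : volume S / 2 + ENNReal.ofReal (v / 4) ≠ ⊤ := ENNReal.add_ne_top.2 ⟨hhalf, ENNReal.ofReal_ne_top⟩
  have hreal := ENNReal.toReal_strict_mono hfin2 hlt
  rw [ENNReal.toReal_add hhalf ENNReal.ofReal_ne_top, ENNReal.toReal_div, ENNReal.toReal_ofReal (by positivity)] at hreal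
  rw [← hvdef] at hreal
  norm_num at hreal
  linarith

end H4Kit

/-- H4 BY NAME: the LEAD-facing H4 statement, now a theorem of the single smaller stub H4a (H4c is proved). -/
theorem stub_haulRace : Sig.stub_haulRace :=
  haulRace_of stub_haulTravel stub_haulBook

/-- FILLED ENDGAME: a classical member whose every slice is irrotational vanishes — by name over
`PastIrrotational.ae_eq_zero_of_gauge_of_pastIrrotational` (`T₁ = 0`; slices are `C^∞` and divergence free by the classical-solution structure). -/
theorem irrotationalEndgame (ρ : ℝ) (hρ : 0 < ρ) (hρ2 : ρ ≤ 1 / 2) (u : ℝ → E3 → E3) (p : ℝ → E3 → ℝ)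
    (H : ℝ → E3 → E3 →L[ℝ] E3) (c : ℝ≥0) (hcls : InClass ρ u p H c)
    (hcl : Literature.Analysis.FluidPDE.IsClassicalEulerSolutionOn (Set.Iio 0) 0 u p)
    (hcurl : ∀ τ : ℝ, τ < 0 → ∀ x : E3, Literature.Analysis.FluidPDE.curl (u τ) x = 0) : VanishesAE u := by
  refine Theorems.PowerGaugeEulerLiouville.PastIrrotational.ae_eq_zero_of_gauge_of_pastIrrotational hρ hρ2 hcls.1 hcls.2.1
    hcls.2.2 le_rfl (fun τ hτ => ?_) (fun τ hτ => hcl.divFree τ hτ) hcurl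
  have hu2 : ContDiff ℝ 2 (u τ) := (hcl.contDiff_velocity hτ).of_le (by norm_cast)
  exact hu2

/-- H6 (OPEN COMPLEMENT — the honest face): the target's hypotheses VERBATIM plus «NOT in the haulable stratum» ⇒ trivial.  Exactly the LEAD's
open stub minus the new stratum; not claimed easier than the crux. -/
def Sig.stub_haulFace : Prop :=
  ∀ ρ : ℝ, 0 < ρ → ρ ≤ 1 / 2 →
    ∀ (u : ℝ → E3 → E3) (p : ℝ → E3 → ℝ) (H : ℝ → E3 → E3 →L[ℝ] E3) (c : ℝ≥0), InClass ρ u p H c →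
      ¬ QuiescentPast u → ¬ IsPastSteady ρ u → ¬ IsWeakTamePast u H → ¬ PastFrozenDirection H → ¬ IsSelfSimilarVelocity u →
      ¬ IsCollapseClockC2 u → ¬ IsPastSelfSimilarClassical ρ u → ¬ IsPastSelfSimilarSubExtremal ρ u → ¬ IsShapeFastClock ρ u →
      ¬ IsSwirlFreeDrifting u p → ¬ IsSwirlFreeSlowDrifting ρ u p → ¬ IsMirrorOutgoing ρ u p → ¬ IsAxisymSlowDrifting ρ u p →
      ¬ IsTameBreather ρ u p → ¬ IsDiscreteBreather ρ u → ¬ IsDiscreteClock ρ u → ¬ IsOffRateSelfSimilar ρ u →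
      ¬ IsBernoulliClockedCore u p → ¬ IsHelicalTubePast ρ u p → ¬ IsStretchingBudgeted ρ u p → ¬ IsAnchoredBudgeted ρ u p →
      ¬ IsConfinedVortex ρ u p → ¬ IsFadingTamePast u p → ¬ IsTameClassicalShapePreserving ρ u p → ¬ HasOneSidedPressurePast ρ u p →
      ¬ IsExtinctConservative ρ u p → ¬ (ρ = 1 / 2 ∧ IsDSSPowerSpread ρ u) → ¬ IsDSSCompactVorticity ρ u p → ¬ IsDSSClassicalTame ρ u p →
      ¬ IsDSSClassicalEnergy ρ u p → ¬ IsClassicalVorticityTame u p → ¬ IsSymmetricWeak u H → ¬ IsWeakFluxTame u p H →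
      ¬ IsClassicalConcentrating ρ u p →
      ¬ IsSlabBoundedSwirlFree u p → VanishesAE u

theorem stub_haulFace : Sig.stub_haulFace := by
  sorry

/-! ## The kernel-checked compositions: the stubs prove the LEAD's open stub BY NAME -/

/-- `casimir_haul` composition: H1–H4 kill the haulable stratum (via the filled irrotational endgame), H6 is the open complement. -/
theorem nonSelfSimilarRest_of (h1 : Sig.stub_ledgerFlow) (h2 : Sig.stub_logPoincareSmallSets) (h3 : Sig.stub_haulingInequality)
    (h4 : Sig.stub_haulRace) (h6 : Sig.stub_haulFace) : Sig.stub_nonSelfSimilarRest := by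
  intro ρ hρ hρ2 u p H c hcls n1 n2 n3 n4 n5 n6 n7 n8 _nsp _ntw n9 n10 n11 n12 _nS _nS' n13 _n13' n14 n15 n16 n17 n18 n19 _nχ n20 n21 n22 n23 n24
    n25 n26 n27 n28 n29 _n29' n30 n31 n32 n33 n34
  by_cases hc : IsSlabBoundedSwirlFree u p
  · exact irrotationalEndgame ρ hρ hρ2 u p H c hcls hc.1 (h4 (h3 h2) ρ hρ u p H c hcls hc (h1 u p hc))
  · exact h6 ρ hρ hρ2 u p H c hcls n1 n2 n3 n4 n5 n6 n7 n8 n9 n10 n11 n12 n13 n14 n15 n16 n17 n18 n19 n20 n21 n22 n23 n24 n25 n26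
      n27 n28 n29 n30 n31 n32 n33 n34 hc

/-- The same composition with the target unfolded to the LEAD's literal statement (documentation of «by name = by text»). -/
theorem nonSelfSimilarRest_of' (h1 : Sig.stub_ledgerFlow) (h2 : Sig.stub_logPoincareSmallSets) (h3 : Sig.stub_haulingInequality)
    (h4 : Sig.stub_haulRace) (h6 : Sig.stub_haulFace) :
    ∀ ρ : ℝ, 0 < ρ → ρ ≤ 1 / 2 →
    ∀ (u : ℝ → E3 → E3) (p : ℝ → E3 → ℝ) (H : ℝ → E3 → E3 →L[ℝ] E3) (c : ℝ≥0), InClass ρ u p H c →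
      ¬ QuiescentPast u → ¬ IsPastSteady ρ u → ¬ IsWeakTamePast u H → ¬ PastFrozenDirection H → ¬ IsSelfSimilarVelocity u →
      ¬ IsCollapseClockC2 u → ¬ IsPastSelfSimilarClassical ρ u → ¬ IsPastSelfSimilarSubExtremal ρ u → ¬ IsPastSpiralSubExtremal ρ u → ¬ IsPastSpiralTameWeak ρ u → ¬ IsShapeFastClock ρ u →
      ¬ IsSwirlFreeDrifting u p → ¬ IsSwirlFreeSlowDrifting ρ u p → ¬ IsMirrorOutgoing ρ u p → ¬ IsSlabBoundedSwirlFree u p →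
      ¬ (∃ R : E3 ≃ₗᵢ[ℝ] E3, IsSlabBoundedSwirlFree (fun τ x => R (u τ (R.symm x))) (fun τ x => p τ (R.symm x))) →
      ¬ IsAxisymSlowDrifting ρ u p →
      ¬ (∃ R : E3 ≃ₗᵢ[ℝ] E3, IsAxisymSlowDrifting ρ (fun τ x => R (u τ (R.symm x))) (fun τ x => p τ (R.symm x))) →
      ¬ IsTameBreather ρ u p → ¬ IsDiscreteBreather ρ u → ¬ IsDiscreteClock ρ u → ¬ IsOffRateSelfSimilar ρ u →
      ¬ IsBernoulliClockedCore u p → ¬ IsHelicalTubePast ρ u p → ¬ IsChiralTubePast u p → ¬ IsStretchingBudgeted ρ u p →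
      ¬ IsAnchoredBudgeted ρ u p →
      ¬ IsConfinedVortex ρ u p → ¬ IsFadingTamePast u p → ¬ IsTameClassicalShapePreserving ρ u p → ¬ HasOneSidedPressurePast ρ u p →
      ¬ IsExtinctConservative ρ u p → ¬ (ρ = 1 / 2 ∧ IsDSSPowerSpread ρ u) → ¬ IsDSSCompactVorticity ρ u p → ¬ IsDSSClassicalTame ρ u p →
      ¬ (∃ R : E3 ≃ₗᵢ[ℝ] E3, IsDSSClassicalTame ρ (fun τ x => R (u τ (R.symm x))) (fun τ x => p τ (R.symm x))) →
      ¬ IsDSSClassicalEnergy ρ u p → ¬ IsClassicalVorticityTame u p → ¬ IsSymmetricWeak u H → ¬ IsWeakFluxTame u p H →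
      ¬ IsClassicalConcentrating ρ u p →
      Function.uncurry u =ᵐ[volume.restrict (Set.Iio (0 : ℝ) ×ˢ (Set.univ : Set E3))] 0 :=
  nonSelfSimilarRest_of h1 h2 h3 h4 h6

/-- REV2 composition over the stub set H1, H2, H3, H4a, H4c, H6 (H4 = `haulRace_of h4a h4c`; H4c is now a theorem). -/
theorem nonSelfSimilarRest_of_split (h1 : Sig.stub_ledgerFlow) (h2 : Sig.stub_logPoincareSmallSets) (h3 : Sig.stub_haulingInequality)
    (h4a : Sig.stub_haulTravel) (h4c : Sig.stub_haulBook) (h6 : Sig.stub_haulFace) : Sig.stub_nonSelfSimilarRest :=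
  nonSelfSimilarRest_of h1 h2 h3 (haulRace_of h4a h4c) h6

/-- REV3 composition (kept by name for readers of REV3): H2, H3, H4a, H6. -/
theorem nonSelfSimilarRest_of_rev3 (h2 : Sig.stub_logPoincareSmallSets) (h3 : Sig.stub_haulingInequality) (h4a : Sig.stub_haulTravel)
    (h6 : Sig.stub_haulFace) : Sig.stub_nonSelfSimilarRest :=
  nonSelfSimilarRest_of_split stub_ledgerFlow h2 h3 h4a stub_haulBook h6

/-- REV4 composition over the CURRENT stub set H3, H6 (H1, H2, H4a filled by name; H4, H4c proved in-file): the stratum kill modulo H3 alone. -/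
theorem nonSelfSimilarRest_of_rev4 (h3 : Sig.stub_haulingInequality) (h6 : Sig.stub_haulFace) : Sig.stub_nonSelfSimilarRest :=
  nonSelfSimilarRest_of_split stub_ledgerFlow stub_logPoincareSmallSets h3 stub_haulTravel stub_haulBook h6

/-- REV4 (kept): the stratum kill modulo H3 as a hypothesis. -/
theorem slabBoundedSwirlFree_trivial_of_h3 (h3 : Sig.stub_haulingInequality) (ρ : ℝ) (hρ : 0 < ρ) (hρ2 : ρ ≤ 1 / 2)
    (u : ℝ → E3 → E3) (p : ℝ → E3 → ℝ) (H : ℝ → E3 → E3 →L[ℝ] E3) (c : ℝ≥0) (hcls : InClass ρ u p H c)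
    (hc : IsSlabBoundedSwirlFree u p) : VanishesAE u :=
  irrotationalEndgame ρ hρ hρ2 u p H c hcls hc.1
    (haulRace_of stub_haulTravel stub_haulBook (h3 stub_logPoincareSmallSets) ρ hρ u p H c hcls hc (stub_ledgerFlow u p hc))

/-- REV6 composition over the CURRENT stub set = {H6} (every kill stub closed). -/
theorem nonSelfSimilarRest_of_rev6 (h6 : Sig.stub_haulFace) : Sig.stub_nonSelfSimilarRest :=
  nonSelfSimilarRest_of_rev4 stub_haulingInequality h6

/-- REV7 (v115 ABSORPTION, documentation): since v115 the target itself carries `¬ IsSlabBoundedSwirlFree u p` (binder 13 of 36), so the open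
complement H6 gives the target by a mere RE-ORDERING of binders — H1–H4 are no longer needed for the composition (they live on in the skeleton's filled
stub `stub_slabBoundedSwirlFree` := `CasimirHaul.slabBoundedSwirlFree_trivial`, ns-sfl-p1 g10 p718198, and in `slabBoundedSwirlFree_trivial` below). -/
theorem nonSelfSimilarRest_of_face (h6 : Sig.stub_haulFace) : Sig.stub_nonSelfSimilarRest :=
  fun ρ hρ hρ2 u p H c hcls n1 n2 n3 n4 n5 n6 n7 n8 _nsp _ntw n9 n10 n11 n12 nS _nS' n13 _n13' n14 n15 n16 n17 n18 n19 _nχ n20 n21 n22 n23 n24 n25 n26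
      n27 n28 n29 _n29' n30 n31 n32 n33 n34 =>
    h6 ρ hρ hρ2 u p H c hcls n1 n2 n3 n4 n5 n6 n7 n8 n9 n10 n11 n12 n13 n14 n15 n16 n17 n18 n19 n20 n21 n22 n23 n24 n25 n26 n27 n28 n29 n30 n31
      n32 n33 n34 nS

/-- ★ REV6 — THE CLASSICAL AXISYMMETRIC SWIRL-FREE SLAB-BOUNDED STRATUM IS EMPTY (sorry-free: H1, H2, H3, H4a tree theorems by name; H4, H4c and
the irrotational endgame proved in-file): every class member (`InClass ρ u p H c`, `0 < ρ ≤ ½`) that is a classical axisymmetric swirl-free Euler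
solution with velocity bounded on compact past slabs vanishes a.e. on the slab.  `#print axioms` should list only the standard trio.  (The same
statement, δ-unfolded, is ALSO the tree theorem `Theorems.PowerGaugeEulerLiouville.CasimirHaul.slabBoundedSwirlFree_trivial`, ns-sfl-p1 g10 p718198, assembled
from the Theorems ports of H1–H4; this in-file proof is the line's own chain.) -/
theorem slabBoundedSwirlFree_trivial (ρ : ℝ) (hρ : 0 < ρ) (hρ2 : ρ ≤ 1 / 2)
    (u : ℝ → E3 → E3) (p : ℝ → E3 → ℝ) (H : ℝ → E3 → E3 →L[ℝ] E3) (c : ℝ≥0) (hcls : InClass ρ u p H c)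
    (hc : IsSlabBoundedSwirlFree u p) : VanishesAE u :=
  slabBoundedSwirlFree_trivial_of_h3 stub_haulingInequality ρ hρ hρ2 u p H c hcls hc

/-- ★ REV6 corollary: NO NON-TRIVIAL CLASS MEMBER IS SLAB-BOUNDED SWIRL-FREE — the binder `¬ IsSlabBoundedSwirlFree u p` of H6 is earned, not assumed,
for members with a slice of non-zero velocity on a set of positive measure. -/
theorem not_isSlabBoundedSwirlFree_of_inClass (ρ : ℝ) (hρ : 0 < ρ) (hρ2 : ρ ≤ 1 / 2)
    (u : ℝ → E3 → E3) (p : ℝ → E3 → ℝ) (H : ℝ → E3 → E3 →L[ℝ] E3) (c : ℝ≥0) (hcls : InClass ρ u p H c)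
    (hne : ¬ VanishesAE u) : ¬ IsSlabBoundedSwirlFree u p := fun hc =>
  hne (slabBoundedSwirlFree_trivial ρ hρ hρ2 u p H c hcls hc)

/-- The new stratum CONTAINS the killed drift strata (sanity, proved): `IsSwirlFreeDriftingWith u p M κ` members are slab-bounded swirl-free. -/
theorem isSlabBoundedSwirlFree_of_isSwirlFreeDriftingWith {u : ℝ → E3 → E3} {p : ℝ → E3 → ℝ} {M κ : ℝ}
    (h : IsSwirlFreeDriftingWith u p M κ) : IsSlabBoundedSwirlFree u p := by
  refine ⟨h.1, h.2.1, fun T₁ T₀ hT hT₀ => ?_⟩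
  obtain ⟨hM, -, hdrift⟩ := h.2.2
  refine ⟨M * max ((-T₁) ^ (-κ)) ((-T₀) ^ (-κ)), fun τ hτ x => (hdrift τ (lt_of_le_of_lt hτ.2 hT₀) x).trans ?_⟩
  refine mul_le_mul_of_nonneg_left ?_ hM
  -- `(−τ)^{−κ}` lies between its values at the endpoints of `[T₁,T₀]` (monotone in `−τ` either way)
  rcases le_or_gt 0 κ with hκ | hκ
  · refine le_trans ?_ (le_max_right _ _)
    exact Real.rpow_le_rpow_of_nonpos (by linarith) (by linarith [hτ.2]) (by linarith)
  · refine le_trans ?_ (le_max_left _ _)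
    exact Real.rpow_le_rpow (by linarith [hτ.2]) (by linarith [hτ.1]) (by linarith)

end Summit.NavierStokesRegularity.NavierStokesRegularity.Cruxes.PowerGaugeEulerLiouville.CasimirHaul
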